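import Mathlib
import Summits.NavierStokesRegularity.NavierStokesRegularity.Theorems.EulerZoomLiouvillePowerGaugeEulerLiouvilleBirthDefsFive
import Summits.NavierStokesRegularity.NavierStokesRegularity.Theorems.EulerZoomLiouvillePowerGaugeEulerLiouvilleSpiralTameWeakMember
import Summits.NavierStokesRegularity.NavierStokesRegularity.Theorems.EulerZoomLiouvillePowerGaugeEulerLiouvilleSpiralSubExtremalMember
import Summits.NavierStokesRegularity.NavierStokesRegularity.Theorems.EulerZoomLiouvillePowerGaugeEulerLiouvilleCasimirHaulAnyAxis
import Summits.NavierStokesRegularity.NavierStokesRegularity.Theorems.EulerZoomLiouvillePowerGaugeEulerLiouvilleAxisymSlowDriftingAnyAxis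
import Summits.NavierStokesRegularity.NavierStokesRegularity.Theorems.EulerZoomLiouvillePowerGaugeEulerLiouvilleCasimirHaulMember
import Summits.NavierStokesRegularity.NavierStokesRegularity.Theorems.EulerZoomLiouvillePowerGaugeEulerLiouvilleChiralAnchorRaceFinal
import Summits.NavierStokesRegularity.NavierStokesRegularity.Theorems.EulerZoomLiouvillePowerGaugeEulerLiouvilleChiralAnchorShellFloor
import Summits.NavierStokesRegularity.NavierStokesRegularity.Theorems.EulerZoomLiouvillePowerGaugeEulerLiouvilleChiralAnchorFarVolume
import Summits.NavierStokesRegularity.NavierStokesRegularity.Theorems.EulerZoomLiouvillePowerGaugeEulerLiouvilleChiralAnchorTransport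
import Summits.NavierStokesRegularity.NavierStokesRegularity.Theorems.EulerZoomLiouvillePowerGaugeEulerLiouvilleSelfSimilarEndpointBoundedHessian
import Summits.NavierStokesRegularity.NavierStokesRegularity.Theorems.EulerZoomLiouvillePowerGaugeEulerLiouvillePastWeakIrrotational
import Summits.NavierStokesRegularity.NavierStokesRegularity.Theorems.EulerZoomLiouvillePowerGaugeEulerLiouvillePastTravelingWave
import Summits.NavierStokesRegularity.NavierStokesRegularity.Theorems.EulerZoomLiouvillePowerGaugeEulerLiouvilleDSSVorticitySmallQ
import Summits.NavierStokesRegularity.NavierStokesRegularity.Theorems.EulerZoomLiouvillePowerGaugeEulerLiouvilleSelfSimilarNeedleCrossSection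
import Summits.NavierStokesRegularity.NavierStokesRegularity.Theorems.EulerZoomLiouvillePowerGaugeEulerLiouvilleOutgoingFlux
import Summits.NavierStokesRegularity.NavierStokesRegularity.Theorems.EulerZoomLiouvillePowerGaugeEulerLiouvillePeriodic
import Summits.NavierStokesRegularity.NavierStokesRegularity.Theorems.EulerZoomLiouvillePowerGaugeEulerLiouvilleDSSFiniteEnergy
import Summits.NavierStokesRegularity.NavierStokesRegularity.Theorems.EulerZoomLiouvillePowerGaugeEulerLiouvilleDSSEnergySaturation
import Summits.NavierStokesRegularity.NavierStokesRegularity.Theorems.EulerZoomLiouvillePowerGaugeEulerLiouvillePastKelvin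
import Summits.NavierStokesRegularity.NavierStokesRegularity.Theorems.EulerZoomLiouvillePowerGaugeEulerLiouvilleSelfSimilarSubdriftRigidity
import Summits.NavierStokesRegularity.NavierStokesRegularity.Theorems.EulerZoomLiouvillePowerGaugeEulerLiouvilleSelfSimilarCompactVorticityC2
import Summits.NavierStokesRegularity.NavierStokesRegularity.Theorems.EulerZoomLiouvillePowerGaugeEulerLiouvilleSelfSimilarShiftedRadialInflow
import Summits.NavierStokesRegularity.NavierStokesRegularity.Theorems.EulerZoomLiouvillePowerGaugeEulerLiouvilleCompactVortexSlabBounds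
import Summits.NavierStokesRegularity.NavierStokesRegularity.Theorems.EulerZoomLiouvillePowerGaugeEulerLiouvilleCompactVortexStarvation
import Summits.NavierStokesRegularity.NavierStokesRegularity.Theorems.EulerZoomLiouvillePowerGaugeEulerLiouvilleLogtimeBreatherTame
import Summits.NavierStokesRegularity.NavierStokesRegularity.Theorems.EulerZoomLiouvillePowerGaugeEulerLiouvilleFrozenDirectionMember
import Summits.NavierStokesRegularity.NavierStokesRegularity.Theorems.EulerZoomLiouvillePowerGaugeEulerLiouvillePressureFloorSlicewise
import Summits.NavierStokesRegularity.NavierStokesRegularity.Theorems.EulerZoomLiouvillePowerGaugeEulerLiouvillePressureFloorNewtonianBumps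
import Summits.NavierStokesRegularity.NavierStokesRegularity.Theorems.EulerZoomLiouvillePowerGaugeEulerLiouvilleSelfSimilarEndpointShellSpread
import Summits.NavierStokesRegularity.NavierStokesRegularity.Theorems.EulerZoomLiouvillePowerGaugeEulerLiouvilleAxisymSlowDrifting
import Summits.NavierStokesRegularity.NavierStokesRegularity.Theorems.EulerZoomLiouvillePowerGaugeEulerLiouvilleLogtimeBreatherSteepVorticity
import Summits.NavierStokesRegularity.NavierStokesRegularity.Theorems.EulerZoomLiouvillePowerGaugeEulerLiouvilleDiscreteBreather
import Summits.NavierStokesRegularity.NavierStokesRegularity.Theorems.EulerZoomLiouvillePowerGaugeEulerLiouvilleDiscreteClock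
import Summits.NavierStokesRegularity.NavierStokesRegularity.Theorems.EulerZoomLiouvillePowerGaugeEulerLiouvilleHelicityTubeMember
import Summits.NavierStokesRegularity.NavierStokesRegularity.Theorems.EulerZoomLiouvillePowerGaugeEulerLiouvilleStretchingBudgetStratum
import Summits.NavierStokesRegularity.NavierStokesRegularity.Theorems.EulerZoomLiouvillePowerGaugeEulerLiouvilleAnchoredBudgetStratumRev3
import Summits.NavierStokesRegularity.NavierStokesRegularity.Theorems.EulerZoomLiouvillePowerGaugeEulerLiouvilleSelfSimilarEndpointSobolevMember
import Summits.NavierStokesRegularity.NavierStokesRegularity.Theorems.EulerZoomLiouvillePowerGaugeEulerLiouvilleSelfSimilarBernoulliBoundedPast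
import Summits.NavierStokesRegularity.NavierStokesRegularity.Theorems.EulerZoomLiouvillePowerGaugeEulerLiouvilleLogtimeBreatherSmallQ
import Summits.NavierStokesRegularity.NavierStokesRegularity.Theorems.EulerZoomLiouvillePowerGaugeEulerLiouvilleNeedleCorePersistence
import Summits.NavierStokesRegularity.NavierStokesRegularity.Theorems.EulerZoomLiouvillePowerGaugeEulerLiouvilleNeedleSphereGrowth
import Summits.NavierStokesRegularity.NavierStokesRegularity.Theorems.EulerZoomLiouvillePowerGaugeEulerLiouvilleMirrorMomentMember
import Summits.NavierStokesRegularity.NavierStokesRegularity.Theorems.EulerZoomLiouvillePowerGaugeEulerLiouvilleSelfSimilarNegClockPast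
import Summits.NavierStokesRegularity.NavierStokesRegularity.Theorems.EulerZoomLiouvillePowerGaugeEulerLiouvilleSelfSimilarOwnRateSubExtremalPast
import Summits.NavierStokesRegularity.NavierStokesRegularity.Theorems.EulerZoomLiouvillePowerGaugeEulerLiouvilleDSSEndpointSobolevMember
import Summits.NavierStokesRegularity.NavierStokesRegularity.Theorems.EulerZoomLiouvillePowerGaugeEulerLiouvilleSelfSimilarPressureSlavingPast
import Summits.NavierStokesRegularity.NavierStokesRegularity.Theorems.EulerZoomLiouvillePowerGaugeEulerLiouvilleDSSPressureSlavingMember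
import Summits.NavierStokesRegularity.NavierStokesRegularity.Theorems.EulerZoomLiouvillePowerGaugeEulerLiouvillePowerClockRigidityAll
import Summits.NavierStokesRegularity.NavierStokesRegularity.Theorems.EulerZoomLiouvillePowerGaugeEulerLiouvilleDiscreteClockNegRate
import Summits.NavierStokesRegularity.NavierStokesRegularity.Theorems.EulerZoomLiouvillePowerGaugeEulerLiouvilleFadingPastShifted
import Summits.NavierStokesRegularity.NavierStokesRegularity.Theorems.EulerZoomLiouvillePowerGaugeEulerLiouvilleStretchingBudgetStratumFree
import Summits.NavierStokesRegularity.NavierStokesRegularity.Theorems.EulerZoomLiouvillePowerGaugeEulerLiouvilleHelicityTubeMemberFree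
import Summits.NavierStokesRegularity.NavierStokesRegularity.Theorems.EulerZoomLiouvillePowerGaugeEulerLiouvilleDSSEndpointSobolevSupMember
import Summits.NavierStokesRegularity.NavierStokesRegularity.Theorems.EulerZoomLiouvillePowerGaugeEulerLiouvilleSimilarityBernoulliMemberDepletion
import Summits.NavierStokesRegularity.NavierStokesRegularity.Theorems.EulerZoomLiouvillePowerGaugeEulerLiouvilleClockTransfer
import Summits.NavierStokesRegularity.NavierStokesRegularity.Theorems.EulerZoomLiouvillePowerGaugeEulerLiouvilleSelfSimilarBernoulliSqueezeFreeMember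
import Summits.NavierStokesRegularity.NavierStokesRegularity.Theorems.EulerZoomLiouvillePowerGaugeEulerLiouvillePastFramePeriodic
import Summits.NavierStokesRegularity.NavierStokesRegularity.Theorems.EulerZoomLiouvillePowerGaugeEulerLiouvilleNeedleStrainClockPast
import Summits.NavierStokesRegularity.NavierStokesRegularity.Theorems.EulerZoomLiouvillePowerGaugeEulerLiouvilleExtinctL4
import Summits.NavierStokesRegularity.NavierStokesRegularity.Theorems.EulerZoomLiouvillePowerGaugeEulerLiouvilleSelfSimilarVortexDominated
import Summits.NavierStokesRegularity.NavierStokesRegularity.Theorems.EulerZoomLiouvillePowerGaugeEulerLiouvilleChannelClockMember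
import Summits.NavierStokesRegularity.NavierStokesRegularity.Theorems.EulerZoomLiouvillePowerGaugeEulerLiouvilleChannelClockPast
import Summits.NavierStokesRegularity.NavierStokesRegularity.Theorems.EulerZoomLiouvillePowerGaugeEulerLiouvilleVirialFormAbs
import Summits.NavierStokesRegularity.NavierStokesRegularity.Theorems.EulerZoomLiouvillePowerGaugeEulerLiouvilleDriftClockDecayMember
import Summits.NavierStokesRegularity.NavierStokesRegularity.Theorems.EulerZoomLiouvillePowerGaugeEulerLiouvilleGalileanWanderingKill
import Summits.NavierStokesRegularity.NavierStokesRegularity.Theorems.EulerZoomLiouvillePowerGaugeEulerLiouvilleSelfSimilarStrainExcessGrowthPast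
import Summits.NavierStokesRegularity.NavierStokesRegularity.Theorems.EulerZoomLiouvillePowerGaugeEulerLiouvilleCondenserMinimalTypePast
import Summits.NavierStokesRegularity.NavierStokesRegularity.Theorems.EulerZoomLiouvillePowerGaugeEulerLiouvilleSelfSimilarSwirlBudgetTwins
import Summits.NavierStokesRegularity.NavierStokesRegularity.Theorems.EulerZoomLiouvillePowerGaugeEulerLiouvilleDSSVorticitySupportOneSlice
import Summits.NavierStokesRegularity.NavierStokesRegularity.Theorems.EulerZoomLiouvillePowerGaugeEulerLiouvillePastTwisted
import Summits.NavierStokesRegularity.NavierStokesRegularity.Theorems.EulerZoomLiouvillePowerGaugeEulerLiouvilleBreatherWeakPast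
import Summits.NavierStokesRegularity.NavierStokesRegularity.Theorems.EulerZoomLiouvillePowerGaugeEulerLiouvilleDSSEtaRatchet
import Summits.NavierStokesRegularity.NavierStokesRegularity.Theorems.EulerZoomLiouvillePowerGaugeEulerLiouvilleDSSCountableNodesMemberPointwise
import Summits.NavierStokesRegularity.NavierStokesRegularity.Theorems.EulerZoomLiouvillePowerGaugeEulerLiouvilleDSSNodeThinOrKill
import Summits.NavierStokesRegularity.NavierStokesRegularity.Theorems.EulerZoomLiouvillePowerGaugeEulerLiouvilleDSSFiniteNodesMemberPointwise
import Summits.NavierStokesRegularity.NavierStokesRegularity.Theorems.EulerZoomLiouvillePowerGaugeEulerLiouvilleSelfSimilarSwirlSlowInflowLocal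
import Summits.NavierStokesRegularity.NavierStokesRegularity.Theorems.EulerZoomLiouvillePowerGaugeEulerLiouvilleNeedleHoveringLocal
import Summits.NavierStokesRegularity.NavierStokesRegularity.Theorems.EulerZoomLiouvillePowerGaugeEulerLiouvilleDriftClockPerigeeMember
import Summits.NavierStokesRegularity.NavierStokesRegularity.Theorems.EulerZoomLiouvillePowerGaugeEulerLiouvilleDriftClockAvoidMember
import Summits.NavierStokesRegularity.NavierStokesRegularity.Theorems.EulerZoomLiouvillePowerGaugeEulerLiouvilleRadialPressureFormAbs
import Summits.NavierStokesRegularity.NavierStokesRegularity.Theorems.EulerZoomLiouvillePowerGaugeEulerLiouvilleRigidFramePrecessing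
import Summits.NavierStokesRegularity.NavierStokesRegularity.Theorems.EulerZoomLiouvillePowerGaugeEulerLiouvilleCondenserInfiniteType
import Summits.NavierStokesRegularity.NavierStokesRegularity.Theorems.EulerZoomLiouvillePowerGaugeEulerLiouvilleCondenserWindowSummability
import Summits.NavierStokesRegularity.NavierStokesRegularity.Theorems.EulerZoomLiouvillePowerGaugeEulerLiouvilleLastExitCriticalSpikes
import Summits.NavierStokesRegularity.NavierStokesRegularity.Theorems.EulerZoomLiouvillePowerGaugeEulerLiouvilleWeakConfinedVorticityIntrinsic
import Summits.NavierStokesRegularity.NavierStokesRegularity.Theorems.EulerZoomLiouvillePowerGaugeEulerLiouvilleWeakIntegrableVorticity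
import Summits.NavierStokesRegularity.NavierStokesRegularity.Theorems.EulerZoomLiouvillePowerGaugeEulerLiouvilleHoopStraightRunMember
import Summits.NavierStokesRegularity.NavierStokesRegularity.Theorems.EulerZoomLiouvillePowerGaugeEulerLiouvilleHoopStraightRunFreeMember
import Summits.NavierStokesRegularity.NavierStokesRegularity.Theorems.EulerZoomLiouvillePowerGaugeEulerLiouvilleWeakSupportDensityLaw
import Summits.NavierStokesRegularity.NavierStokesRegularity.Theorems.EulerZoomLiouvillePowerGaugeEulerLiouvilleHoopRidgeRunMember
import Summits.NavierStokesRegularity.NavierStokesRegularity.Theorems.EulerZoomLiouvillePowerGaugeEulerLiouvilleFatCoreMember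
import Summits.NavierStokesRegularity.NavierStokesRegularity.Theorems.EulerZoomLiouvillePowerGaugeEulerLiouvilleWeakCasimirRace
import Summits.NavierStokesRegularity.NavierStokesRegularity.Theorems.EulerZoomLiouvillePowerGaugeEulerLiouvilleCondenserWindowSummation
import Summits.NavierStokesRegularity.NavierStokesRegularity.Theorems.EulerZoomLiouvillePowerGaugeEulerLiouvilleDriftClockLevel
import Summits.NavierStokesRegularity.NavierStokesRegularity.Theorems.EulerZoomLiouvillePowerGaugeEulerLiouvilleDriftClockScaleMember
import Summits.NavierStokesRegularity.NavierStokesRegularity.Theorems.EulerZoomLiouvillePowerGaugeEulerLiouvilleMomentFloorMember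
import Summits.NavierStokesRegularity.NavierStokesRegularity.Theorems.EulerZoomLiouvillePowerGaugeEulerLiouvilleWeakVorticityEquation
import Summits.NavierStokesRegularity.NavierStokesRegularity.Theorems.EulerZoomLiouvillePowerGaugeEulerLiouvilleWeakVorticityRenormalisation
import Summits.NavierStokesRegularity.NavierStokesRegularity.Theorems.EulerZoomLiouvillePowerGaugeEulerLiouvilleWeakAxisymAnyAxis
import Summits.NavierStokesRegularity.NavierStokesRegularity.Theorems.EulerZoomLiouvillePowerGaugeEulerLiouvilleMomentFloorClosed

/-!
# Lead skeleton v119 (19832 LEAD-of-record ns-typeII-p2 g17) of the crux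
# `EulerZoomLiouville.PowerGaugeEulerLiouville` (stmt-NavierStokesRegularity-19832, line `birth`)

v119 (ns-typeII-p2 g17) = v118 + SPIRAL PARITY for the four REGULARITY-FREE senses (ns-ezl-w3 g9, key W3-SPAR): the spiral (O(3)-twisted self-similar) twins of disjuncts 2–5 of `IsPastSelfSimilarSubExtremal` — `L^q` profile tail `2 ≤ q ≤ 3/(1+ρ)`, confined weak curl (a.e.-symmetric weak gradient off a ball), weakly irrotational far field (test-function form), integrable + `L²` curl (all `ρ < ½`) — killed BY NAME: new binder `¬ IsPastSpiralTameWeak ρ u` of `stub_nonSelfSimilarRest` (predicate in `Theorems/…BirthDefsFive` p727264, four existentials over `IsSkew S ∧ IsPastSpiral ρ T T₁ x₀ S u V ∧ <disjunct 2/3/4/5 verbatim>`) and new FILLED stub `stub_pastSpiralTameWeak` := member `Spiral.pastSpiralTameWeak_trivial` (each sense reduced at PROFILE level — `LpProfile.subExtremal_of_memLp`, `WeakConfinedVorticity.memLp_two_exterior_of_confinedCurl`, `ae_symm_of_curlPair_eq_zero`, `memLp_two_of_integrableCurl` — to the sub-extremal / `L²`-tail case, then the spiral dictionary `Spiral.exists_locData_of_pastSpiral`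 p727126 ∘ the radial endgame `Spiral.pastSpiral_trivial_of_locData_of_subExtremal` p724254).  With v118's `¬ IsPastSpiralSubExtremal` the spiral stratum now has parity with all five regularity-free senses of the untwisted past-self-similar stratum; the CLASSICAL spiral senses (R2 of line `relative_equilibria`, first lemma `Sig.lemma_spiralVorticalEscape`) stay OPEN (obstruction: the axial angular-momentum term `(1−2γ)U·Sy` in `W_S·∇ℋ_S`; ns-sfl-p1 g11 R2-ESC box).  52 stubs / 49 filled / 3 open.

v118 (ns-typeII-p2 g17) = v117 + the SUB-EXTREMAL SPIRAL stratum (O(3)-TWISTED self-similar members, Perelman's ansatz `u(τ,x) = (T−τ)^{γ−1} e^{(log(T−τ))S} V(e^{−(log(T−τ))S}(T−τ)^{−γ}(x−x₀))`, `S` skew, `γ = 1/(2+ρ)`, on a past sub-slab `τ < T₁ ≤ min(0,T)`) with SUB-EXTREMAL profile energy `liminf_L L^{2ρ−1}∫_{B_L}|V|² = 0`, killed BY NAME: new binder `¬ IsPastSpiralSubExtremal ρ u` of `stub_nonSelfSimilarRest` (predicate in `Theorems/…BirthDefsFour`, texts of line `relative_equilibria` (ns-idea-11 g9–g12) R3 VERBATIM)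 and new FILLED stub `stub_pastSpiralSubExtremal` := member `Spiral.pastSpiralSubExtremal_trivial` (R3a spiral dictionary = `Past.exists_locData_of_past` ported brick by brick: P2 (A₁) / P3 profile gradient + (E₁) ns-idea-11 g11/g12 + ns-ezl-w1 g10, P4 pressure slaving + (D₁) ns-sfl-p1 g11, P5 extension ns-ezl-w1 g10, P6 profile equation ns-ezl-w2 g8, P7 radial energy equality ns-ezl-w3 g9, assembly + member ns-ezl-w1 g10 (`Spiral.exists_locData_of_pastSpiral`) + LEAD g17 (radial endgame p724254 `…SpiralEndgame`, defs p725060 `…BirthDefsFour`, member `…SpiralSubExtremalMember`); composed with the Bronzi–Shvydkoy radial endgame `ae_eq_zero_of_subExtremal_loc_radial`).  `S = 0` is the already-filled `stub_pastSelfSimilarSubExtremal`.  W-REG DECISION recorded (regularity audit ns-ezl-w3 g9 / ns-ezl-w2 g8, evidence W-REG-a.md / W-REG-ezl-w2.md): THE ONE STATEMENT keeps `ContDiff ℝ 2 V` (0/11 + 1/35 members free at C¹; C² enters through `IsSelfSimilarEulerProfile.contDiff_velocity` + gateway, the weighted-curl Cauchy formula, and `C2.Kelvin` trapped-set nullity).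  51 stubs / 48 filled / 3 open.

HISTORY v12–v111 (ns-typeII-p2 g8–g16): per-version change logs are ARCHIVED verbatim in the HOME mirrors `run/shared/lean/pub/ns-regularity-ideate/ns-typeII-p2/Lines-birth-vNN.lean`
and summarised in `CENSUS-19832-vNN.md` (evidence on the crux item); docstring diets gen/diet74…92.py keep the file under the 200 kB crux-write limit (credits → CENSUS files).
Refuter-facing portrait of THE ONE STATEMENT: RESIDUE-MEMO-19832-g13.md §1–§6 (earlier g10 §2/§5, g11 §0–§3).
-/




open MeasureTheory Set Filter Topology Metric
open scoped ENNReal NNReal ContDiff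

set_option linter.dupNamespace false

namespace Summit.NavierStokesRegularity.NavierStokesRegularity.Cruxes.PowerGaugeEulerLiouville.Birth

open Summit.NavierStokesRegularity.NavierStokesRegularity.Theorems.PowerGaugeEulerLiouville.Birth

-- The binder predicates `E3`, `InClass`, …, `IsWeakConfinedCurl` (52 reducible defs, texts of v116 VERBATIM) live since v117 in the reviewed
-- Theorems defs files `…BirthDefsThree` (+ part 1), namespace `…Theorems.PowerGaugeEulerLiouville.Birth` (opened above); new binders are born here and migrate in batches.

/-- Signature of `stub_largeRho` (FILLED; credits: CENSUS-vNN). -/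
def Sig.stub_largeRho : Prop :=
  ∀ ρ : ℝ, 1 / 2 < ρ → ∀ (u : ℝ → E3 → E3) (p : ℝ → E3 → ℝ) (H : ℝ → E3 → E3 →L[ℝ] E3) (c : ℝ≥0),
    InClass ρ u p H c →
      Function.uncurry u =ᵐ[volume.restrict (Set.Iio (0 : ℝ) ×ˢ (Set.univ : Set E3))] 0

/-- Signature of `stub_quiescentPast` (FILLED; credits: CENSUS-vNN). -/
def Sig.stub_quiescentPast : Prop :=
  ∀ ρ : ℝ, 0 < ρ → ρ ≤ 1 / 2 →
    ∀ (u : ℝ → E3 → E3) (p : ℝ → E3 → ℝ) (H : ℝ → E3 → E3 →L[ℝ] E3) (c : ℝ≥0),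
      InClass ρ u p H c → QuiescentPast u →
        Function.uncurry u =ᵐ[volume.restrict (Set.Iio (0 : ℝ) ×ˢ (Set.univ : Set E3))] 0

/-- Signature of `stub_pastSteady` (FILLED; credits: CENSUS-vNN). -/
def Sig.stub_pastSteady : Prop :=
  ∀ ρ : ℝ, 0 < ρ → ρ ≤ 1 / 2 →
    ∀ (u : ℝ → E3 → E3) (p : ℝ → E3 → ℝ) (H : ℝ → E3 → E3 →L[ℝ] E3) (c : ℝ≥0),
      InClass ρ u p H c → IsPastSteady ρ u →
        Function.uncurry u =ᵐ[volume.restrict (Set.Iio (0 : ℝ) ×ˢ (Set.univ : Set E3))] 0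

/-- Signature of `stub_weakTamePast` (FILLED; credits: CENSUS-vNN). -/
def Sig.stub_weakTamePast : Prop :=
  ∀ ρ : ℝ, 0 < ρ → ρ ≤ 1 / 2 →
    ∀ (u : ℝ → E3 → E3) (p : ℝ → E3 → ℝ) (H : ℝ → E3 → E3 →L[ℝ] E3) (c : ℝ≥0),
      InClass ρ u p H c → IsWeakTamePast u H →
        Function.uncurry u =ᵐ[volume.restrict (Set.Iio (0 : ℝ) ×ˢ (Set.univ : Set E3))] 0

/-- Signature of `stub_selfSimilarSubExtremal` (FILLED; credits: CENSUS-vNN). -/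
def Sig.stub_selfSimilarSubExtremal : Prop :=
  ∀ ρ : ℝ, 0 < ρ → ρ ≤ 1 / 2 →
    ∀ (u : ℝ → E3 → E3) (p : ℝ → E3 → ℝ) (H : ℝ → E3 → E3 →L[ℝ] E3) (c : ℝ≥0) (V : E3 → E3) (P : E3 → ℝ),
      InClass ρ u p H c → IsExactlySelfSimilar ρ u p V P → ¬ IsExtremalProfile ρ V →
        Function.uncurry u =ᵐ[volume.restrict (Set.Iio (0 : ℝ) ×ˢ (Set.univ : Set E3))] 0

/-- Signature of `stub_classicalConcentrating` (FILLED; credits: CENSUS-vNN). -/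
def Sig.stub_classicalConcentrating : Prop :=
  ∀ ρ : ℝ, 0 < ρ → ρ ≤ 1 / 2 →
    ∀ (u : ℝ → E3 → E3) (p : ℝ → E3 → ℝ) (H : ℝ → E3 → E3 →L[ℝ] E3) (c : ℝ≥0),
      InClass ρ u p H c → IsClassicalConcentrating ρ u p →
        Function.uncurry u =ᵐ[volume.restrict (Set.Iio (0 : ℝ) ×ˢ (Set.univ : Set E3))] 0

/-- Signature of `stub_selfSimilarClassical` (FILLED; credits: CENSUS-vNN). -/
def Sig.stub_selfSimilarClassical : Prop :=
  ∀ ρ : ℝ, 0 < ρ → ρ ≤ 1 / 2 →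
    ∀ (u : ℝ → E3 → E3) (p : ℝ → E3 → ℝ) (H : ℝ → E3 → E3 →L[ℝ] E3) (c : ℝ≥0) (V : E3 → E3) (P : E3 → ℝ),
      InClass ρ u p H c → IsExactlySelfSimilar ρ u p V P → (IsTameC2Profile ρ V ∨ IsHomogeneousProfile ρ V) →
        Function.uncurry u =ᵐ[volume.restrict (Set.Iio (0 : ℝ) ×ˢ (Set.univ : Set E3))] 0

/-- Signature of `stub_selfSimilarEndpointPowerSpread` (FILLED; credits: CENSUS-vNN). -/
def Sig.stub_selfSimilarEndpointPowerSpread : Prop :=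
  ∀ ρ : ℝ, 0 < ρ → ρ ≤ 1 / 2 →
    ∀ (u : ℝ → E3 → E3) (p : ℝ → E3 → ℝ) (H : ℝ → E3 → E3 →L[ℝ] E3) (c : ℝ≥0) (V : E3 → E3) (P : E3 → ℝ),
      InClass ρ u p H c → IsExactlySelfSimilar ρ u p V P → ρ = 1 / 2 → IsPowerSpreadProfile V →
        Function.uncurry u =ᵐ[volume.restrict (Set.Iio (0 : ℝ) ×ˢ (Set.univ : Set E3))] 0

/-- Signature of `stub_dssEndpointPowerSpread` (FILLED; credits: CENSUS-vNN). -/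
def Sig.stub_dssEndpointPowerSpread : Prop :=
  ∀ ρ : ℝ, 0 < ρ → ρ ≤ 1 / 2 →
    ∀ (u : ℝ → E3 → E3) (p : ℝ → E3 → ℝ) (H : ℝ → E3 → E3 →L[ℝ] E3) (c : ℝ≥0),
      InClass ρ u p H c → ρ = 1 / 2 → IsDSSPowerSpread ρ u →
        Function.uncurry u =ᵐ[volume.restrict (Set.Iio (0 : ℝ) ×ˢ (Set.univ : Set E3))] 0

/-- Signature of `stub_dssCompactVorticity` (FILLED; credits: CENSUS-vNN). -/
def Sig.stub_dssCompactVorticity : Prop :=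
  ∀ ρ : ℝ, 0 < ρ → ρ ≤ 1 / 2 →
    ∀ (u : ℝ → E3 → E3) (p : ℝ → E3 → ℝ) (H : ℝ → E3 → E3 →L[ℝ] E3) (c : ℝ≥0),
      InClass ρ u p H c → IsDSSCompactVorticity ρ u p →
        Function.uncurry u =ᵐ[volume.restrict (Set.Iio (0 : ℝ) ×ˢ (Set.univ : Set E3))] 0

/-- Signature of `stub_dssClassicalTame` (FILLED; credits: CENSUS-vNN). -/
def Sig.stub_dssClassicalTame : Prop :=
  ∀ ρ : ℝ, 0 < ρ → ρ ≤ 1 / 2 →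
    ∀ (u : ℝ → E3 → E3) (p : ℝ → E3 → ℝ) (H : ℝ → E3 → E3 →L[ℝ] E3) (c : ℝ≥0),
      InClass ρ u p H c → IsDSSClassicalTame ρ u p →
        Function.uncurry u =ᵐ[volume.restrict (Set.Iio (0 : ℝ) ×ˢ (Set.univ : Set E3))] 0

/-- Signature of `stub_dssClassicalTameAnyAxis` (FILLED in-skeleton: the classical DSS vorticity-tame stratum — whose senses 2/3 are axisymmetric about `e₃` — transported to ANY axis by `ClassIsometry.ae_eq_zero_of_conj` p718442 ∘ `stub_dssClassicalTame`; credits: CENSUS-v116). -/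
def Sig.stub_dssClassicalTameAnyAxis : Prop :=
  ∀ ρ : ℝ, 0 < ρ → ρ ≤ 1 / 2 →
    ∀ (u : ℝ → E3 → E3) (p : ℝ → E3 → ℝ) (H : ℝ → E3 → E3 →L[ℝ] E3) (c : ℝ≥0),
      InClass ρ u p H c → (∃ R : E3 ≃ₗᵢ[ℝ] E3, IsDSSClassicalTame ρ (fun τ x => R (u τ (R.symm x))) (fun τ x => p τ (R.symm x))) →
        Function.uncurry u =ᵐ[volume.restrict (Set.Iio (0 : ℝ) ×ˢ (Set.univ : Set E3))] 0

/-- Signature of `stub_dssClassicalEnergy` (FILLED; credits: CENSUS-vNN). -/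
def Sig.stub_dssClassicalEnergy : Prop :=
  ∀ ρ : ℝ, 0 < ρ → ρ ≤ 1 / 2 →
    ∀ (u : ℝ → E3 → E3) (p : ℝ → E3 → ℝ) (H : ℝ → E3 → E3 →L[ℝ] E3) (c : ℝ≥0),
      InClass ρ u p H c → IsDSSClassicalEnergy ρ u p →
        Function.uncurry u =ᵐ[volume.restrict (Set.Iio (0 : ℝ) ×ˢ (Set.univ : Set E3))] 0

/-- Signature of `stub_weakFluxTame` (FILLED; credits: CENSUS-vNN). -/
def Sig.stub_weakFluxTame : Prop :=
  ∀ ρ : ℝ, 0 < ρ → ρ ≤ 1 / 2 →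
    ∀ (u : ℝ → E3 → E3) (p : ℝ → E3 → ℝ) (H : ℝ → E3 → E3 →L[ℝ] E3) (c : ℝ≥0),
      InClass ρ u p H c → IsWeakFluxTame u p H →
        Function.uncurry u =ᵐ[volume.restrict (Set.Iio (0 : ℝ) ×ˢ (Set.univ : Set E3))] 0

/-- Signature of `stub_smallTypeIGradient` (FILLED; credits: CENSUS-vNN). -/
def Sig.stub_smallTypeIGradient : Prop :=
  ∀ ρ : ℝ, 0 < ρ → ρ ≤ 1 / 2 →
    ∀ (u : ℝ → E3 → E3) (p : ℝ → E3 → ℝ) (H : ℝ → E3 → E3 →L[ℝ] E3) (c : ℝ≥0),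
      InClass ρ u p H c → IsClassicalVorticityTame u p →
        Function.uncurry u =ᵐ[volume.restrict (Set.Iio (0 : ℝ) ×ˢ (Set.univ : Set E3))] 0

/-- Signature of `stub_symmetricWeak` (FILLED; credits: CENSUS-vNN). -/
def Sig.stub_symmetricWeak : Prop :=
  ∀ ρ : ℝ, 0 < ρ → ρ ≤ 1 / 2 →
    ∀ (u : ℝ → E3 → E3) (p : ℝ → E3 → ℝ) (H : ℝ → E3 → E3 →L[ℝ] E3) (c : ℝ≥0),
      InClass ρ u p H c → IsSymmetricWeak u H →
        Function.uncurry u =ᵐ[volume.restrict (Set.Iio (0 : ℝ) ×ˢ (Set.univ : Set E3))] 0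

/-- Signature of `stub_selfSimilarBoundedBernoulli` (FILLED; credits: CENSUS-vNN). -/
def Sig.stub_selfSimilarBoundedBernoulli : Prop :=
  ∀ ρ : ℝ, 0 < ρ → ρ ≤ 1 / 2 →
    ∀ (u : ℝ → E3 → E3) (p : ℝ → E3 → ℝ) (H : ℝ → E3 → E3 →L[ℝ] E3) (c : ℝ≥0) (V : E3 → E3) (P : E3 → ℝ),
      InClass ρ u p H c → IsExactlySelfSimilar ρ u p V P → ContDiff ℝ 2 V → HasTameVorticalBernoulli ρ V →
        Function.uncurry u =ᵐ[volume.restrict (Set.Iio (0 : ℝ) ×ˢ (Set.univ : Set E3))] 0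

/-- Signature of `stub_selfSimilarFastChannel` (FILLED; credits: CENSUS-vNN). -/
def Sig.stub_selfSimilarFastChannel : Prop :=
  ∀ ρ : ℝ, 0 < ρ → ρ ≤ 1 / 2 →
    ∀ (u : ℝ → E3 → E3) (p : ℝ → E3 → ℝ) (H : ℝ → E3 → E3 →L[ℝ] E3) (c : ℝ≥0) (V : E3 → E3) (P : E3 → ℝ),
      InClass ρ u p H c → IsExactlySelfSimilar ρ u p V P → ContDiff ℝ 2 V → HasFastVorticalChannel ρ V →
        Function.uncurry u =ᵐ[volume.restrict (Set.Iio (0 : ℝ) ×ˢ (Set.univ : Set E3))] 0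

/-- Signature of `stub_selfSimilarClockedExits` (FILLED; credits: CENSUS-vNN). -/
def Sig.stub_selfSimilarClockedExits : Prop :=
  ∀ ρ : ℝ, 0 < ρ → ρ ≤ 1 / 2 →
    ∀ (u : ℝ → E3 → E3) (p : ℝ → E3 → ℝ) (H : ℝ → E3 → E3 →L[ℝ] E3) (c : ℝ≥0) (V : E3 → E3) (P : E3 → ℝ),
      InClass ρ u p H c → IsExactlySelfSimilar ρ u p V P → ContDiff ℝ 2 V → HasResidenceClock ρ V →
        Function.uncurry u =ᵐ[volume.restrict (Set.Iio (0 : ℝ) ×ˢ (Set.univ : Set E3))] 0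

/-- Signature of `stub_selfSimilarAxisymThinExits` (FILLED; credits: CENSUS-vNN). -/
def Sig.stub_selfSimilarAxisymThinExits : Prop :=
  ∀ ρ : ℝ, 0 < ρ → ρ ≤ 1 / 2 →
    ∀ (u : ℝ → E3 → E3) (p : ℝ → E3 → ℝ) (H : ℝ → E3 → E3 →L[ℝ] E3) (c : ℝ≥0) (V : E3 → E3) (P : E3 → ℝ),
      InClass ρ u p H c → IsExactlySelfSimilar ρ u p V P → ContDiff ℝ 2 V →
        (∃ R : E3 ≃ₗᵢ[ℝ] E3, Literature.Analysis.FluidPDE.IsAxisymmetric (fun y => R (V (R.symm y)))) →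
        Function.uncurry u =ᵐ[volume.restrict (Set.Iio (0 : ℝ) ×ˢ (Set.univ : Set E3))] 0

/-- Signature of `stub_selfSimilarC2Needle` — THE ONE STATEMENT (OPEN since v27; text v76 → v102 `¬ IsWeakConfinedCurl` → v104 `¬ IsKinematicTameProfile ρ c V`; the MEANING of
its binders widened v82–v103, see CENSUS-19832-vNN.md): in the window, an exactly self-similar member of the class with constant `c` with an EXTREMAL `C²` velocity profile that is
NOT kinematically tame (fourteen senses; v105–v108: no straight slow∧high runs — quiet walls (8), quiet end caps only (8′), quiet wall at any ratio Λ/β (8″), no straight pressure-ridge runs; v109: no `b`-fat fast core (DUST kept); v111: vorticity NOT in `L^q` for any `q < 3γ` and NOT sub-borderline in any `q`-mean, `q < 1` (THE FLOOR, R53)), has NO Bernoulli piercing, NO tame vortical Bernoulli levels, NO fast vortical channel (twelve senses), NO residence clock (nine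
senses), NO axis of symmetry and NO confined/integrable curl (three senses) is trivial.  Portrait of what survives: RESIDUE-MEMO-19832-g13.md §4–§6 and -g14.md §7–§12. -/
def Sig.stub_selfSimilarC2Needle : Prop :=
  ∀ ρ : ℝ, 0 < ρ → ρ ≤ 1 / 2 →
    ∀ (u : ℝ → E3 → E3) (p : ℝ → E3 → ℝ) (H : ℝ → E3 → E3 →L[ℝ] E3) (c : ℝ≥0) (V : E3 → E3) (P : E3 → ℝ),
      InClass ρ u p H c → IsExactlySelfSimilar ρ u p V P → IsExtremalProfile ρ V → ContDiff ℝ 2 V → ¬ IsKinematicTameProfile ρ c V →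
        ¬ HasBernoulliPiercing ρ V → ¬ HasTameVorticalBernoulli ρ V → ¬ HasFastVorticalChannel ρ V → ¬ HasResidenceClock ρ V →
        ¬ (∃ R : E3 ≃ₗᵢ[ℝ] E3, Literature.Analysis.FluidPDE.IsAxisymmetric (fun y => R (V (R.symm y)))) → ¬ IsWeakConfinedCurl ρ V →
        Function.uncurry u =ᵐ[volume.restrict (Set.Iio (0 : ℝ) ×ˢ (Set.univ : Set E3))] 0

/-- Signature of `stub_selfSimilarWeakRest` (OPEN, NEW in v27 — the WEAK half of the former `stub_selfSimilarExtremalRest`): in the window, an exactly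
self-similar member with an EXTREMAL profile whose velocity profile is NOT `C²` (the genuinely weak class: Chae–Shvydkoy's window proper), NOT
critically homogeneous, at `ρ = ½` WITHOUT the power spread, the member NOT classical-concentrating, the profile NOT weak-with-confined-curl (v99), is trivial. -/
def Sig.stub_selfSimilarWeakRest : Prop :=
  ∀ ρ : ℝ, 0 < ρ → ρ ≤ 1 / 2 →
    ∀ (u : ℝ → E3 → E3) (p : ℝ → E3 → ℝ) (H : ℝ → E3 → E3 →L[ℝ] E3) (c : ℝ≥0) (V : E3 → E3) (P : E3 → ℝ),
      InClass ρ u p H c → IsExactlySelfSimilar ρ u p V P → IsExtremalProfile ρ V → ¬ ContDiff ℝ 2 V →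
        ¬ IsHomogeneousProfile ρ V → ¬ (ρ = 1 / 2 ∧ IsPowerSpreadProfile V) → ¬ IsClassicalConcentrating ρ u p → ¬ IsWeakConfinedCurl ρ V →
        Function.uncurry u =ᵐ[volume.restrict (Set.Iio (0 : ℝ) ×ˢ (Set.univ : Set E3))] 0

/-- Signature of `stub_selfSimilarWeakConfinedCurl` (FILLED; credits: CENSUS-vNN). -/
def Sig.stub_selfSimilarWeakConfinedCurl : Prop :=
  ∀ ρ : ℝ, 0 < ρ → ρ ≤ 1 / 2 →
    ∀ (u : ℝ → E3 → E3) (p : ℝ → E3 → ℝ) (H : ℝ → E3 → E3 →L[ℝ] E3) (c : ℝ≥0) (V : E3 → E3) (P : E3 → ℝ),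
      InClass ρ u p H c → IsExactlySelfSimilar ρ u p V P → IsWeakConfinedCurl ρ V →
        Function.uncurry u =ᵐ[volume.restrict (Set.Iio (0 : ℝ) ×ˢ (Set.univ : Set E3))] 0

/-- Signature of `stub_shiftedSelfSimilarClassical` (FILLED; credits: CENSUS-vNN). -/
def Sig.stub_shiftedSelfSimilarClassical : Prop :=
  ∀ ρ : ℝ, 0 < ρ → ρ ≤ 1 / 2 →
    ∀ (u : ℝ → E3 → E3) (p : ℝ → E3 → ℝ) (H : ℝ → E3 → E3 →L[ℝ] E3) (c : ℝ≥0),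
      InClass ρ u p H c → IsPastSelfSimilarClassical ρ u →
        Function.uncurry u =ᵐ[volume.restrict (Set.Iio (0 : ℝ) ×ˢ (Set.univ : Set E3))] 0

/-- Signature of `stub_pastSelfSimilarSubExtremal` (FILLED; credits: CENSUS-vNN). -/
def Sig.stub_pastSelfSimilarSubExtremal : Prop :=
  ∀ ρ : ℝ, 0 < ρ → ρ ≤ 1 / 2 →
    ∀ (u : ℝ → E3 → E3) (p : ℝ → E3 → ℝ) (H : ℝ → E3 → E3 →L[ℝ] E3) (c : ℝ≥0),
      InClass ρ u p H c → IsPastSelfSimilarSubExtremal ρ u →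
        Function.uncurry u =ᵐ[volume.restrict (Set.Iio (0 : ℝ) ×ˢ (Set.univ : Set E3))] 0

/-- Signature of `stub_pastSpiralSubExtremal` (FILLED; line `relative_equilibria` R3 — sub-extremal SPIRAL (O(3)-twisted self-similar) members; credits: CENSUS-v118). -/
def Sig.stub_pastSpiralSubExtremal : Prop :=
  ∀ ρ : ℝ, 0 < ρ → ρ ≤ 1 / 2 →
    ∀ (u : ℝ → E3 → E3) (p : ℝ → E3 → ℝ) (H : ℝ → E3 → E3 →L[ℝ] E3) (c : ℝ≥0),
      InClass ρ u p H c → IsPastSpiralSubExtremal ρ u →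
        Function.uncurry u =ᵐ[volume.restrict (Set.Iio (0 : ℝ) ×ˢ (Set.univ : Set E3))] 0

/-- Signature of `stub_pastSpiralTameWeak` (FILLED; spiral twins of the four regularity-free senses of `IsPastSelfSimilarSubExtremal`; ns-ezl-w3 g9 W3-SPAR; credits: CENSUS-v119). -/
def Sig.stub_pastSpiralTameWeak : Prop :=
  ∀ ρ : ℝ, 0 < ρ → ρ ≤ 1 / 2 →
    ∀ (u : ℝ → E3 → E3) (p : ℝ → E3 → ℝ) (H : ℝ → E3 → E3 →L[ℝ] E3) (c : ℝ≥0),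
      InClass ρ u p H c → IsPastSpiralTameWeak ρ u →
        Function.uncurry u =ᵐ[volume.restrict (Set.Iio (0 : ℝ) ×ˢ (Set.univ : Set E3))] 0

/-- Signature of `stub_shapeFastClock` (FILLED; credits: CENSUS-vNN). -/
def Sig.stub_shapeFastClock : Prop :=
  ∀ ρ : ℝ, 0 < ρ → ρ ≤ 1 / 2 →
    ∀ (u : ℝ → E3 → E3) (p : ℝ → E3 → ℝ) (H : ℝ → E3 → E3 →L[ℝ] E3) (c : ℝ≥0),
      InClass ρ u p H c → IsShapeFastClock ρ u →
        Function.uncurry u =ᵐ[volume.restrict (Set.Iio (0 : ℝ) ×ˢ (Set.univ : Set E3))] 0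

/-- Signature of `stub_swirlFreeDrifting` (FILLED; credits: CENSUS-vNN). -/
def Sig.stub_swirlFreeDrifting : Prop :=
  ∀ ρ : ℝ, 0 < ρ → ρ ≤ 1 / 2 →
    ∀ (u : ℝ → E3 → E3) (p : ℝ → E3 → ℝ) (H : ℝ → E3 → E3 →L[ℝ] E3) (c : ℝ≥0),
      InClass ρ u p H c → IsSwirlFreeDrifting u p →
        Function.uncurry u =ᵐ[volume.restrict (Set.Iio (0 : ℝ) ×ˢ (Set.univ : Set E3))] 0

/-- Signature of `stub_bernoulliClockedCore` (FILLED; credits: CENSUS-vNN). -/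
def Sig.stub_bernoulliClockedCore : Prop :=
  ∀ ρ : ℝ, 0 < ρ → ρ ≤ 1 / 2 →
    ∀ (u : ℝ → E3 → E3) (p : ℝ → E3 → ℝ) (H : ℝ → E3 → E3 →L[ℝ] E3) (c : ℝ≥0),
      InClass ρ u p H c → IsBernoulliClockedCore u p →
        Function.uncurry u =ᵐ[volume.restrict (Set.Iio (0 : ℝ) ×ˢ (Set.univ : Set E3))] 0

/-- Signature of `stub_helicalTubePast` (FILLED; credits: CENSUS-vNN). -/
def Sig.stub_helicalTubePast : Prop :=
  ∀ ρ : ℝ, 0 < ρ → ρ ≤ 1 / 2 →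
    ∀ (u : ℝ → E3 → E3) (p : ℝ → E3 → ℝ) (H : ℝ → E3 → E3 →L[ℝ] E3) (c : ℝ≥0),
      InClass ρ u p H c → IsHelicalTubePast ρ u p →
        Function.uncurry u =ᵐ[volume.restrict (Set.Iio (0 : ℝ) ×ˢ (Set.univ : Set E3))] 0

/-- Signature of `stub_chiralTubePast` (FILLED; line `chiral_anchor`, ns-idea-11 g10 / ns-ezl-w3 g8 / ns-ezl-w1 g9; credits: CENSUS-19832-vNN.md). -/
def Sig.stub_chiralTubePast : Prop :=
  ∀ ρ : ℝ, 0 < ρ → ρ ≤ 1 / 2 →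
    ∀ (u : ℝ → E3 → E3) (p : ℝ → E3 → ℝ) (H : ℝ → E3 → E3 →L[ℝ] E3) (c : ℝ≥0),
      InClass ρ u p H c → IsChiralTubePast u p →
        Function.uncurry u =ᵐ[volume.restrict (Set.Iio (0 : ℝ) ×ˢ (Set.univ : Set E3))] 0

/-- Signature of `stub_stretchingBudgeted` (FILLED; credits: CENSUS-vNN). -/
def Sig.stub_stretchingBudgeted : Prop :=
  ∀ ρ : ℝ, 0 < ρ → ρ ≤ 1 / 2 →
    ∀ (u : ℝ → E3 → E3) (p : ℝ → E3 → ℝ) (H : ℝ → E3 → E3 →L[ℝ] E3) (c : ℝ≥0),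
      InClass ρ u p H c → IsStretchingBudgeted ρ u p →
        Function.uncurry u =ᵐ[volume.restrict (Set.Iio (0 : ℝ) ×ˢ (Set.univ : Set E3))] 0

/-- Signature of `stub_anchoredBudgeted` (FILLED; credits: CENSUS-vNN). -/
def Sig.stub_anchoredBudgeted : Prop :=
  ∀ ρ : ℝ, 0 < ρ → ρ ≤ 1 / 2 →
    ∀ (u : ℝ → E3 → E3) (p : ℝ → E3 → ℝ) (H : ℝ → E3 → E3 →L[ℝ] E3) (c : ℝ≥0),
      InClass ρ u p H c → IsAnchoredBudgeted ρ u p →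
        Function.uncurry u =ᵐ[volume.restrict (Set.Iio (0 : ℝ) ×ˢ (Set.univ : Set E3))] 0

/-- Signature of `stub_confinedVortex` (FILLED; credits: CENSUS-vNN). -/
def Sig.stub_confinedVortex : Prop :=
  ∀ ρ : ℝ, 0 < ρ → ρ ≤ 1 / 2 →
    ∀ (u : ℝ → E3 → E3) (p : ℝ → E3 → ℝ) (H : ℝ → E3 → E3 →L[ℝ] E3) (c : ℝ≥0),
      InClass ρ u p H c → IsConfinedVortex ρ u p →
        Function.uncurry u =ᵐ[volume.restrict (Set.Iio (0 : ℝ) ×ˢ (Set.univ : Set E3))] 0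

/-- Signature of `stub_fadingTamePast` (FILLED; credits: CENSUS-vNN). -/
def Sig.stub_fadingTamePast : Prop :=
  ∀ ρ : ℝ, 0 < ρ → ρ ≤ 1 / 2 →
    ∀ (u : ℝ → E3 → E3) (p : ℝ → E3 → ℝ) (H : ℝ → E3 → E3 →L[ℝ] E3) (c : ℝ≥0),
      InClass ρ u p H c → IsFadingTamePast u p →
        Function.uncurry u =ᵐ[volume.restrict (Set.Iio (0 : ℝ) ×ˢ (Set.univ : Set E3))] 0

/-- Signature of `stub_pastFrozenDirection` (FILLED; credits: CENSUS-vNN). -/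
def Sig.stub_pastFrozenDirection : Prop :=
  ∀ ρ : ℝ, 0 < ρ → ρ ≤ 1 / 2 →
    ∀ (u : ℝ → E3 → E3) (p : ℝ → E3 → ℝ) (H : ℝ → E3 → E3 →L[ℝ] E3) (c : ℝ≥0),
      InClass ρ u p H c → PastFrozenDirection H →
        Function.uncurry u =ᵐ[volume.restrict (Set.Iio (0 : ℝ) ×ˢ (Set.univ : Set E3))] 0

/-- Signature of `stub_tameShapePreserving` (FILLED; credits: CENSUS-vNN). -/
def Sig.stub_tameShapePreserving : Prop :=
  ∀ ρ : ℝ, 0 < ρ → ρ ≤ 1 / 2 →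
    ∀ (u : ℝ → E3 → E3) (p : ℝ → E3 → ℝ) (H : ℝ → E3 → E3 →L[ℝ] E3) (c : ℝ≥0),
      InClass ρ u p H c → IsTameClassicalShapePreserving ρ u p →
        Function.uncurry u =ᵐ[volume.restrict (Set.Iio (0 : ℝ) ×ˢ (Set.univ : Set E3))] 0

/-- Signature of `stub_oneSidedPressurePast` (FILLED; credits: CENSUS-vNN). -/
def Sig.stub_oneSidedPressurePast : Prop :=
  ∀ ρ : ℝ, 0 < ρ → ρ ≤ 1 / 2 →
    ∀ (u : ℝ → E3 → E3) (p : ℝ → E3 → ℝ) (H : ℝ → E3 → E3 →L[ℝ] E3) (c : ℝ≥0),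
      InClass ρ u p H c → HasOneSidedPressurePast ρ u p →
        Function.uncurry u =ᵐ[volume.restrict (Set.Iio (0 : ℝ) ×ˢ (Set.univ : Set E3))] 0

/-- Signature of `stub_extinctConservative` (FILLED; credits: CENSUS-vNN). -/
def Sig.stub_extinctConservative : Prop :=
  ∀ ρ : ℝ, 0 < ρ → ρ ≤ 1 / 2 →
    ∀ (u : ℝ → E3 → E3) (p : ℝ → E3 → ℝ) (H : ℝ → E3 → E3 →L[ℝ] E3) (c : ℝ≥0),
      InClass ρ u p H c → IsExtinctConservative ρ u p →
        Function.uncurry u =ᵐ[volume.restrict (Set.Iio (0 : ℝ) ×ˢ (Set.univ : Set E3))] 0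

/-- Signature of `stub_swirlFreeSlowDrifting` (FILLED; credits: CENSUS-vNN). -/
def Sig.stub_swirlFreeSlowDrifting : Prop :=
  ∀ ρ : ℝ, 0 < ρ → ρ ≤ 1 / 2 →
    ∀ (u : ℝ → E3 → E3) (p : ℝ → E3 → ℝ) (H : ℝ → E3 → E3 →L[ℝ] E3) (c : ℝ≥0),
      InClass ρ u p H c → IsSwirlFreeSlowDrifting ρ u p →
        Function.uncurry u =ᵐ[volume.restrict (Set.Iio (0 : ℝ) ×ˢ (Set.univ : Set E3))] 0

/-- Signature of `stub_mirrorOutgoing` (FILLED; credits: CENSUS-vNN). -/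
def Sig.stub_mirrorOutgoing : Prop :=
  ∀ ρ : ℝ, 0 < ρ → ρ ≤ 1 / 2 →
    ∀ (u : ℝ → E3 → E3) (p : ℝ → E3 → ℝ) (H : ℝ → E3 → E3 →L[ℝ] E3) (c : ℝ≥0),
      InClass ρ u p H c → IsMirrorOutgoing ρ u p →
        Function.uncurry u =ᵐ[volume.restrict (Set.Iio (0 : ℝ) ×ˢ (Set.univ : Set E3))] 0

/-- Signature of `stub_slabBoundedSwirlFree` (FILLED; line `casimir_haul`; credits: CENSUS-vNN). -/
def Sig.stub_slabBoundedSwirlFree : Prop :=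
  ∀ ρ : ℝ, 0 < ρ → ρ ≤ 1 / 2 →
    ∀ (u : ℝ → E3 → E3) (p : ℝ → E3 → ℝ) (H : ℝ → E3 → E3 →L[ℝ] E3) (c : ℝ≥0),
      InClass ρ u p H c → IsSlabBoundedSwirlFree u p →
        Function.uncurry u =ᵐ[volume.restrict (Set.Iio (0 : ℝ) ×ˢ (Set.univ : Set E3))] 0

/-- Signature of `stub_slabBoundedSwirlFreeAnyAxis` (FILLED; line `casimir_haul` transported to any axis by `ClassIsometry.ae_eq_zero_of_conj`; credits: CENSUS-v116). -/
def Sig.stub_slabBoundedSwirlFreeAnyAxis : Prop :=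
  ∀ ρ : ℝ, 0 < ρ → ρ ≤ 1 / 2 →
    ∀ (u : ℝ → E3 → E3) (p : ℝ → E3 → ℝ) (H : ℝ → E3 → E3 →L[ℝ] E3) (c : ℝ≥0),
      InClass ρ u p H c → (∃ R : E3 ≃ₗᵢ[ℝ] E3, IsSlabBoundedSwirlFree (fun τ x => R (u τ (R.symm x))) (fun τ x => p τ (R.symm x))) →
        Function.uncurry u =ᵐ[volume.restrict (Set.Iio (0 : ℝ) ×ˢ (Set.univ : Set E3))] 0

/-- Signature of `stub_axisymSlowDrifting` (FILLED; credits: CENSUS-vNN). -/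
def Sig.stub_axisymSlowDrifting : Prop :=
  ∀ ρ : ℝ, 0 < ρ → ρ ≤ 1 / 2 →
    ∀ (u : ℝ → E3 → E3) (p : ℝ → E3 → ℝ) (H : ℝ → E3 → E3 →L[ℝ] E3) (c : ℝ≥0),
      InClass ρ u p H c → IsAxisymSlowDrifting ρ u p →
        Function.uncurry u =ᵐ[volume.restrict (Set.Iio (0 : ℝ) ×ˢ (Set.univ : Set E3))] 0

/-- Signature of `stub_axisymSlowDriftingAnyAxis` (FILLED; axisymmetric slow-drifting stratum about any axis; credits: CENSUS-v116). -/
def Sig.stub_axisymSlowDriftingAnyAxis : Prop :=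
  ∀ ρ : ℝ, 0 < ρ → ρ ≤ 1 / 2 →
    ∀ (u : ℝ → E3 → E3) (p : ℝ → E3 → ℝ) (H : ℝ → E3 → E3 →L[ℝ] E3) (c : ℝ≥0),
      InClass ρ u p H c → (∃ R : E3 ≃ₗᵢ[ℝ] E3, IsAxisymSlowDrifting ρ (fun τ x => R (u τ (R.symm x))) (fun τ x => p τ (R.symm x))) →
        Function.uncurry u =ᵐ[volume.restrict (Set.Iio (0 : ℝ) ×ˢ (Set.univ : Set E3))] 0

/-- Signature of `stub_tameBreather` (FILLED; credits: CENSUS-vNN). -/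
def Sig.stub_tameBreather : Prop :=
  ∀ ρ : ℝ, 0 < ρ → ρ ≤ 1 / 2 →
    ∀ (u : ℝ → E3 → E3) (p : ℝ → E3 → ℝ) (H : ℝ → E3 → E3 →L[ℝ] E3) (c : ℝ≥0),
      InClass ρ u p H c → IsTameBreather ρ u p →
        Function.uncurry u =ᵐ[volume.restrict (Set.Iio (0 : ℝ) ×ˢ (Set.univ : Set E3))] 0

/-- Signature of `stub_discreteBreather` (FILLED; credits: CENSUS-vNN). -/
def Sig.stub_discreteBreather : Prop :=
  ∀ ρ : ℝ, 0 < ρ → ρ ≤ 1 / 2 →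
    ∀ (u : ℝ → E3 → E3) (p : ℝ → E3 → ℝ) (H : ℝ → E3 → E3 →L[ℝ] E3) (c : ℝ≥0),
      InClass ρ u p H c → IsDiscreteBreather ρ u →
        Function.uncurry u =ᵐ[volume.restrict (Set.Iio (0 : ℝ) ×ˢ (Set.univ : Set E3))] 0

/-- Signature of `stub_discreteClock` (FILLED; credits: CENSUS-vNN). -/
def Sig.stub_discreteClock : Prop :=
  ∀ ρ : ℝ, 0 < ρ → ρ ≤ 1 / 2 →
    ∀ (u : ℝ → E3 → E3) (p : ℝ → E3 → ℝ) (H : ℝ → E3 → E3 →L[ℝ] E3) (c : ℝ≥0),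
      InClass ρ u p H c → IsDiscreteClock ρ u →
        Function.uncurry u =ᵐ[volume.restrict (Set.Iio (0 : ℝ) ×ˢ (Set.univ : Set E3))] 0

/-- Signature of `stub_offRateSelfSimilar` (FILLED; credits: CENSUS-vNN). -/
def Sig.stub_offRateSelfSimilar : Prop :=
  ∀ ρ : ℝ, 0 < ρ → ρ ≤ 1 / 2 →
    ∀ (u : ℝ → E3 → E3) (p : ℝ → E3 → ℝ) (H : ℝ → E3 → E3 →L[ℝ] E3) (c : ℝ≥0),
      InClass ρ u p H c → IsOffRateSelfSimilar ρ u →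
        Function.uncurry u =ᵐ[volume.restrict (Set.Iio (0 : ℝ) ×ˢ (Set.univ : Set E3))] 0

/-- Signature of `stub_selfSimilarKinematicTame` (FILLED; credits: CENSUS-vNN). -/
def Sig.stub_selfSimilarKinematicTame : Prop :=
  ∀ ρ : ℝ, 0 < ρ → ρ ≤ 1 / 2 →
    ∀ (u : ℝ → E3 → E3) (p : ℝ → E3 → ℝ) (H : ℝ → E3 → E3 →L[ℝ] E3) (c : ℝ≥0) (V : E3 → E3) (P : E3 → ℝ),
      InClass ρ u p H c → IsExactlySelfSimilar ρ u p V P → ContDiff ℝ 2 V → IsKinematicTameProfile ρ c V →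
        Function.uncurry u =ᵐ[volume.restrict (Set.Iio (0 : ℝ) ×ˢ (Set.univ : Set E3))] 0

/-- Signature of `stub_nonSelfSimilarRest` (OPEN; reshaped v17–v74, binder history in the CENSUS files): in the window, a member with energy present at `t = −∞` lying in
NONE of the landed past / clock / DSS / weak strata named by the binders below (velocity-only binders since v54/v58) is trivial. -/
def Sig.stub_nonSelfSimilarRest : Prop :=
  ∀ ρ : ℝ, 0 < ρ → ρ ≤ 1 / 2 →
    ∀ (u : ℝ → E3 → E3) (p : ℝ → E3 → ℝ) (H : ℝ → E3 → E3 →L[ℝ] E3) (c : ℝ≥0),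
      InClass ρ u p H c → ¬ QuiescentPast u → ¬ IsPastSteady ρ u → ¬ IsWeakTamePast u H → ¬ PastFrozenDirection H →
        ¬ IsSelfSimilarVelocity u → ¬ IsCollapseClockC2 u →
        ¬ IsPastSelfSimilarClassical ρ u → ¬ IsPastSelfSimilarSubExtremal ρ u → ¬ IsPastSpiralSubExtremal ρ u → ¬ IsPastSpiralTameWeak ρ u → ¬ IsShapeFastClock ρ u →
        ¬ IsSwirlFreeDrifting u p → ¬ IsSwirlFreeSlowDrifting ρ u p → ¬ IsMirrorOutgoing ρ u p → ¬ IsSlabBoundedSwirlFree u p → ¬ (∃ R : E3 ≃ₗᵢ[ℝ] E3, IsSlabBoundedSwirlFree (fun τ x => R (u τ (R.symm x))) (fun τ x => p τ (R.symm x))) → ¬ IsAxisymSlowDrifting ρ u p → ¬ (∃ R : E3 ≃ₗᵢ[ℝ] E3, IsAxisymSlowDrifting ρ (fun τ x => R (u τ (R.symm x))) (fun τ x => p τ (R.symm x))) → ¬ IsTameBreather ρ u p → ¬ IsDiscreteBreather ρ u → ¬ IsDiscreteClock ρ u →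
        ¬ IsOffRateSelfSimilar ρ u →
        ¬ IsBernoulliClockedCore u p → ¬ IsHelicalTubePast ρ u p → ¬ IsChiralTubePast u p → ¬ IsStretchingBudgeted ρ u p → ¬ IsAnchoredBudgeted ρ u p →
        ¬ IsConfinedVortex ρ u p → ¬ IsFadingTamePast u p →
        ¬ IsTameClassicalShapePreserving ρ u p → ¬ HasOneSidedPressurePast ρ u p → ¬ IsExtinctConservative ρ u p →
        ¬ (ρ = 1 / 2 ∧ IsDSSPowerSpread ρ u) → ¬ IsDSSCompactVorticity ρ u p →
        ¬ IsDSSClassicalTame ρ u p → ¬ (∃ R : E3 ≃ₗᵢ[ℝ] E3, IsDSSClassicalTame ρ (fun τ x => R (u τ (R.symm x))) (fun τ x => p τ (R.symm x))) → ¬ IsDSSClassicalEnergy ρ u p → ¬ IsClassicalVorticityTame u p → ¬ IsSymmetricWeak u H →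
        ¬ IsWeakFluxTame u p H → ¬ IsClassicalConcentrating ρ u p →
        Function.uncurry u =ᵐ[volume.restrict (Set.Iio (0 : ℝ) ×ˢ (Set.univ : Set E3))] 0

/-- STUB 1 [FILLED BY NAME: p476480]. -/
theorem stub_largeRho : Sig.stub_largeRho :=
  fun ρ hρ u p H c h =>
    Theorems.PowerGaugeEulerLiouville.powerGaugeEulerLiouville_largeRho
      ρ hρ u p H c h.1 h.2.1 h.2.2

/-- STUB 2 [FILLED BY NAME: p503599, threshold-free]. -/
theorem stub_quiescentPast : Sig.stub_quiescentPast :=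
  fun _ρ hρ _ u p H c h hq =>
    Theorems.PowerGaugeEulerLiouville.ae_eq_zero_of_gauge_of_energyVanishing_allRho
      (u := u) (p := p) (H := H) (c := c) hρ.le h.1 h.2.1 h.2.2 hq

/-- STUB 2s [FILLED BY NAME; fillers and credits: CENSUS-19832-vNN.md, branch comments below]. -/
theorem stub_pastSteady : Sig.stub_pastSteady := by
  intro ρ hρ hρh u p H c h hps
  rcases hps with ⟨T₁, hT₁, v, hv⟩ | ⟨T₁, P, d, w, hT₁, hP, hu⟩ | ⟨T₁, K, β, U, ξ, η, hT₁, hK, hβ, hu, hξ⟩ | ⟨T₁, v, Q, hT₁, hu⟩ | ⟨T₁, P, L, hT₁, hP, hu⟩ |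
    ⟨T₁, U, ξ, η, hT₁, hξ, hu⟩ | ⟨T, T₁, ξ, η, V, τ₁, τ₂, hT₁, hT, hξ, hu, hτ₁, hτ₂, hdrift⟩ |
    ⟨T₁, K, β, U, R, ξ, η, hT₁, hK, hβ, hu, hξ⟩ | ⟨T₁, U, R, ξ, η, hT₁, hR, hξ, hu⟩ | ⟨T₁, U, A, ξ, η, hT₁, hA, hAs, hξ, hu⟩
  · exact
      Theorems.PowerGaugeEulerLiouville.PastSteady.ae_eq_zero_of_gauge_of_pastSteady
        hρ h.1 h.2.1 h.2.2 hT₁ hv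
  · exact
      Theorems.PowerGaugeEulerLiouville.FramePeriodic.ae_eq_zero_of_gauge_of_pastFramePeriodic
        hρ h.1 h.2.1 h.2.2 hT₁ hP hu
  · exact
      Theorems.PowerGaugeEulerLiouville.FrameSteady.ae_eq_zero_of_gauge_of_pastFrameSteady_confined
        hρ (by linarith) h.1 h.2.1 h.2.2 hT₁ hu hK hβ hξ
  · exact
      Theorems.PowerGaugeEulerLiouville.Twisted.ae_eq_zero_of_gauge_of_pastTwistedSteady
        hρ h.1 h.2.1 h.2.2 hT₁ hu
  · exact
      Theorems.PowerGaugeEulerLiouville.Twisted.ae_eq_zero_of_gauge_of_pastTwistedPeriodic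
        hρ h.1 h.2.1 h.2.2 hT₁ hP hu
  · -- v81: every frame-steady past member with a C¹ frame path
    exact
      Theorems.PowerGaugeEulerLiouville.GalileanFrames.frameSteady_ae_eq_zero
        hρ hρh h.1 h.2.1 h.2.2 hT₁ hξ hu
  · -- v83: wandering drifting past
    exact
      Theorems.PowerGaugeEulerLiouville.GalileanFrames.wandering_ae_eq_zero_of_drift_ne
        hρ hρh h.1 h.2.1 h.2.2 hT₁ hT hξ hu hτ₁ hτ₂ hdrift
  · -- v84: rigid-frame-steady past with confined centre
    exact
      Theorems.PowerGaugeEulerLiouville.RigidFrame.ae_eq_zero_of_gauge_of_pastRigidFrameSteady_confined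
        hρ (by linarith) h.1 h.2.1 h.2.2 hT₁ hu hK hβ hξ
  · -- v89/v90
    exact
      Theorems.PowerGaugeEulerLiouville.RigidFrame.ae_eq_zero_of_gauge_of_isPastRigidFrameSteadyC1
        hρ hρh h.1 h.2.1 h.2.2 ⟨T₁, U, R, ξ, η, hT₁, hR, hξ, hu⟩
  · -- v95 alt 10: precessing frames (ns-ezl-w3 g6 p682991)
    exact
      Theorems.PowerGaugeEulerLiouville.RigidFrame.ae_eq_zero_of_gauge_of_pastPrecessingFrameSteady
        hρ hρh h.1 h.2.1 h.2.2 hT₁ hA hAs hξ hu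

/-- STUB `stub_weakTamePast` [FILLED BY NAME; credits: CENSUS-vNN]. -/
theorem stub_weakTamePast : Sig.stub_weakTamePast := by
  intro ρ hρ _ u p H c h hw
  rcases hw with ⟨T₁, hT₁, hirr⟩ | ⟨T₁, hT₁, v, hv, hper⟩ | ⟨T₁, hT₁, L, y₀, w, hw0, hLw, hsym⟩ | ⟨T₁, hT₁, P, hP, hper⟩ | htight |
    ⟨T₁, hT₁, U, G₀, b, hu, hHf⟩
  · exact
      Theorems.PowerGaugeEulerLiouville.PastWeak.ae_eq_zero_of_gauge_of_pastWeaklyIrrotational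
        hρ h.1 h.2.1 h.2.2 hT₁ hirr
  · exact
      Theorems.PowerGaugeEulerLiouville.PastSymmetric.ae_eq_zero_of_gauge_of_pastSpacePeriodic
        hρ h.1 h.2.1 h.2.2 hT₁ hv hper
  · exact
      Theorems.PowerGaugeEulerLiouville.PastSymmetric.ae_eq_zero_of_gauge_of_pastScrewSymmetric
        hρ h.1 h.2.1 h.2.2 hT₁ L hw0 hLw hsym
  · exact
      Theorems.PowerGaugeEulerLiouville.PastPeriodic.ae_eq_zero_of_gauge_of_pastTimePeriodic
        hρ h.1 h.2.1 h.2.2 hT₁ hP hper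
  · exact
      Theorems.PowerGaugeEulerLiouville.ae_eq_zero_of_gauge_of_tight_allRho
        hρ h.1 h.2.1 h.2.2 htight
  · exact
      Theorems.PowerGaugeEulerLiouville.PastTravel.ae_eq_zero_of_gauge_of_pastTravelingWave
        hρ h.1 h.2.1 h.2.2 hT₁ hu hHf

/-- STUB 3 [FILLED BY NAME; fillers and credits: CENSUS-19832-vNN.md, branch comments below]. -/
theorem stub_selfSimilarSubExtremal : Sig.stub_selfSimilarSubExtremal := by
  intro ρ hρ hρh u p H c V P h hss hnex
  have hsub : ∀ ε : ℝ, 0 < ε → ∀ L₀ : ℝ, ∃ L : ℝ, L₀ ≤ L ∧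
      L ^ (2 * ρ - 1) * ∫ y in Metric.ball (0 : E3) L, ‖V y‖ ^ 2 < ε := by
    intro ε hε L₀
    by_contra hcon
    push Not at hcon
    exact hnex ⟨ε, hε, L₀, hcon⟩
  exact
    Theorems.PowerGaugeEulerLiouville.EnergySaturation.selfSimilar_ae_eq_zero_of_subExtremal
      hρ (by linarith) h.1 h.2.1 h.2.2 hss.1 hss.2 hsub

/-- STUB `stub_classicalConcentrating` [FILLED BY NAME; credits: CENSUS-vNN]. -/
theorem stub_classicalConcentrating : Sig.stub_classicalConcentrating := by
  intro ρ hρ _ u p H c h hcc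
  obtain ⟨hcl, ⟨M, hM⟩, ⟨K, hK⟩, hfar, ⟨β, C, R₀, hβ, hR₀, htail⟩, hu2⟩ := hcc
  exact
    Theorems.PowerGaugeEulerLiouville.KelvinPhysical.ae_eq_zero_of_gauge_of_concentrating
      hρ h.1 h.2.1 h.2.2 hcl hM hK hfar hβ hR₀ htail hu2

/-- STUB `stub_selfSimilarClassical` [FILLED BY NAME; credits: CENSUS-vNN]. -/
theorem stub_selfSimilarClassical : Sig.stub_selfSimilarClassical := by
  intro ρ hρ hρh u p H c V P h hss hcl
  rcases hcl with ⟨hV, hUC | hpi⟩ | hhom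
  · exact
      Theorems.PowerGaugeEulerLiouville.Loc.selfSimilar_ae_eq_zero_of_uniformContinuousC2_profile
        hρ hρh h.1 h.2.2 hss.1 hss.2 hV hUC
  · exact
      Theorems.PowerGaugeEulerLiouville.Loc.selfSimilar_ae_eq_zero_of_piercingBernoulliC2_profile
        hρ hρh h.1 h.2.2 hss.1 hss.2 hV hpi
  · exact
      Theorems.PowerGaugeEulerLiouville.SteadyProfile.selfSimilar_ae_eq_zero_of_homogeneousProfile
        hρ h.1 h.2.1 h.2.2 hss.1 hhom

/-- STUB `stub_shiftedSelfSimilarClassical` [FILLED BY NAME; credits: CENSUS-vNN]. -/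
theorem stub_shiftedSelfSimilarClassical : Sig.stub_shiftedSelfSimilarClassical := by
  intro ρ hρ hρh u p H c h hsh
  rcases hsh with ⟨T, T₁, x₀, V, hT₁, hTT₁, hu, hV, hcl⟩ | ⟨T, T₁, x₀, V, hT₁, hTT₁, hu, hhom⟩ |
    ⟨T, T₁, x₀, V, hT₁, hTT₁, hu, hV, hbb | ⟨hB, hQ⟩⟩ | ⟨T, T₁, x₀, V, hT₁, hTT₁, hu, hV, hfc⟩ | ⟨T, T₁, x₀, V, hT₁, hTT₁, hu, hV, R, hax⟩ |
    ⟨T, T₁, x₀, V, hT₁, hTT₁, hu, hV, hck⟩ |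
    ⟨T, T₁, x₀, V, hT₁, hTT₁, hu, hV, hmin⟩
  rotate_right 6
  · -- PAST PRESSURE SLAVING
    obtain ⟨Q, p', -, hp', -, h'⟩ := Theorems.PowerGaugeEulerLiouville.PressureSlaving.inClass_pastSelfSimilarPressure (g := 1 / (2 + ρ)) (by linarith) hT₁ hTT₁ h hu
    exact
      Theorems.PowerGaugeEulerLiouville.Past.selfSimilar_ae_eq_zero_of_boundedBernoulliC2_profile_past
        hρ hρh hT₁ hTT₁ x₀ h'.1 h'.2.1 h'.2.2 hu hp' hV hbb
  · -- v79: general past twin of the T2 growth stratum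
    obtain ⟨Q, p', -, hp', -, h'⟩ := Theorems.PowerGaugeEulerLiouville.PressureSlaving.inClass_pastSelfSimilarPressure (g := 1 / (2 + ρ)) (by linarith) hT₁ hTT₁ h hu
    exact
      Theorems.PowerGaugeEulerLiouville.PressureParking.selfSimilar_ae_eq_zero_of_strainExcessGrowth_boundedVorticalBernoulliC2_profile_past
        hρ hρh hT₁ hTT₁ x₀ h'.1 h'.2.1 h'.2.2 hu hp' hV hB hQ
  · -- v83: past twin of «any fast channel kills»
    obtain ⟨Q, p', -, hp', -, h'⟩ := Theorems.PowerGaugeEulerLiouville.PressureSlaving.inClass_pastSelfSimilarPressure (g := 1 / (2 + ρ)) (by linarith) hT₁ hTT₁ h hu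
    rcases hfc with ⟨c₁, hc₁, hB⟩ | ⟨c₁, μ, hc₁, hμ, hB⟩ | ⟨c₁, μ, hc₁, hμ, hB⟩ | ⟨κb, a₀, hκb, ha₀, hB⟩ | ⟨c₁, μ, hc₁, hμ, hB⟩ | ⟨κb, a₀, hκb, ha₀, hB⟩ | ⟨κb, a₀, hκb, ha₀, hB⟩ | ⟨κb, a₀, hκb, ha₀, hB⟩ |
      ⟨κb, a₀, e₁, e₂, hκb, ha₀, he₁, he₁ρ, he₂, he₂ρ, hB⟩ | hB10 |
      ⟨κb, a₀, e₁, e₂, hκb, ha₀, he₁, he₁ρ, he₂, he₂ρ, hB⟩ | hB12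
    · exact
        Theorems.PowerGaugeEulerLiouville.Past.selfSimilar_ae_eq_zero_of_vorticalChannelC2_profile_anyRate_past
          hρ hρh hT₁ hTT₁ x₀ h'.1 h'.2.1 h'.2.2 hu hp' hV hc₁ hB
    · exact
        Theorems.PowerGaugeEulerLiouville.Past.selfSimilar_ae_eq_zero_of_inflowBandDeficitC2_profile_past
          hρ hρh hT₁ hTT₁ x₀ h'.1 h'.2.1 h'.2.2 hu hp' hV hc₁ hμ hB
    · -- v85: virial deficit past twin (ns-ezl-w1 g6 p671706)
      exact
        Theorems.PowerGaugeEulerLiouville.Past.selfSimilar_ae_eq_zero_of_virialDeficitC2_profile_past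
          hρ hρh hT₁ hTT₁ x₀ h'.1 h'.2.1 h'.2.2 hu hp' hV hc₁ hμ hB
    · -- v86: absolute inflow-band deficit past twin (LEAD g13)
      exact
        Theorems.PowerGaugeEulerLiouville.Past.selfSimilar_ae_eq_zero_of_absBandDeficitC2_profile_past
          hρ hρh hT₁ hTT₁ x₀ h'.1 h'.2.1 h'.2.2 hu hp' hV hκb ha₀ hB
    · -- v86: radial-pressure form past twin (ns-sfl-p1 g6 p673283)
      exact
        Theorems.PowerGaugeEulerLiouville.Past.selfSimilar_ae_eq_zero_of_radialPressureDeficitC2_profile_past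
          hρ hρh hT₁ hTT₁ x₀ h'.1 h'.2.1 h'.2.2 hu hp' hV hc₁ hμ hB
    · -- v87: absolute virial past twin (ns-ezl-w1 g6 p674543)
      exact
        Theorems.PowerGaugeEulerLiouville.Past.selfSimilar_ae_eq_zero_of_absVirialDeficitC2_profile_past
          hρ hρh hT₁ hTT₁ x₀ h'.1 h'.2.1 h'.2.2 hu hp' hV hκb ha₀ hB
    · -- v87: decaying floor past twin (LEAD g13)
      exact
        Theorems.PowerGaugeEulerLiouville.Past.selfSimilar_ae_eq_zero_of_decayingBandDeficitC2_profile_past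
          hρ hρh hT₁ hTT₁ x₀ h'.1 h'.2.1 h'.2.2 hu hp' hV hκb ha₀ hB
    · -- v89: absolute radial-pressure past twin (ns-sfl-p1 g6 K-sfl)
      exact
        Theorems.PowerGaugeEulerLiouville.Past.selfSimilar_ae_eq_zero_of_absRadialPressureDeficitC2_profile_past
          hρ hρh hT₁ hTT₁ x₀ h'.1 h'.2.1 h'.2.2 hu hp' hV hκb ha₀ hB
    · -- v89: rpow power-band past twin (ns-ezl-w1 g6 T-H)
      exact
        Theorems.PowerGaugeEulerLiouville.Past.selfSimilar_ae_eq_zero_of_powerBandDeficitC2_profile_past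
          hρ hρh hT₁ hTT₁ x₀ h'.1 h'.2.1 h'.2.2 hu hp' hV hκb ha₀ he₁ he₁ρ he₂ he₂ρ hB
    · -- v90: invariant-region band deficit past twin
      exact
        Theorems.PowerGaugeEulerLiouville.Past.selfSimilar_ae_eq_zero_of_invariantBandDeficitC2_profile_past
          hρ hρh hT₁ hTT₁ x₀ h'.1 h'.2.1 h'.2.2 hu hp' hV hB10
    · -- v91: level form past twin (ns-ezl-w1 g6 K-w1-LEVEL)
      exact
        Theorems.PowerGaugeEulerLiouville.Past.selfSimilar_ae_eq_zero_of_powerBandDeficitC2_level_past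
          hρ hρh hT₁ hTT₁ x₀ h'.1 h'.2.1 h'.2.2 hu hp' hV hκb ha₀ he₁ he₁ρ he₂ he₂ρ hB
    · -- v93: deficit off an a.e.-avoided set, past twin
      exact
        Theorems.PowerGaugeEulerLiouville.Past.selfSimilar_ae_eq_zero_of_avoidingBandDeficitC2_profile_past
          hρ hρh hT₁ hTT₁ x₀ h'.1 h'.2.1 h'.2.2 hu hp' hV hB12
  · -- v60/v63/v64
    -- v68 ANY AXIS: generic past ∃R transport (ns-ezl-w3 g3 (N) `ClassIsometry.pastSelfSimilar_ae_eq_zero_of_conj`), twins on the conjugated profile, centre `R x₀`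
    obtain ⟨Q, p', -, hp', -, h'⟩ := Theorems.PowerGaugeEulerLiouville.PressureSlaving.inClass_pastSelfSimilarPressure (g := 1 / (2 + ρ)) (by linarith) hT₁ hTT₁ h hu
    have hW : ContDiff ℝ 2 (fun y => R (V (R.symm y))) :=
      R.toContinuousLinearEquiv.contDiff.comp (hV.comp R.symm.toContinuousLinearEquiv.contDiff)
    refine Theorems.PowerGaugeEulerLiouville.ClassIsometry.pastSelfSimilar_ae_eq_zero_of_conj x₀ h'.1 h'.2.1 h'.2.2 hu hp' R ?_
    intro u₂ p₂ H₂ hsw₂ hH₂ hg₂ hu₂ hp₂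
    exact
      Theorems.PowerGaugeEulerLiouville.SwirlBudget.selfSimilar_ae_eq_zero_of_axisymC2_past
        hρ hρh hT₁ hTT₁ (R x₀) hsw₂ hH₂ hg₂ hu₂ hp₂ hW hax
  · -- v71: the PAST residence-clock stratum
    obtain ⟨Q, p', -, hp', -, h'⟩ := Theorems.PowerGaugeEulerLiouville.PressureSlaving.inClass_pastSelfSimilarPressure (g := 1 / (2 + ρ)) (by linarith) hT₁ hTT₁ h hu
    rcases hck with ⟨s₁, hs₁, hclock⟩ | hclock | ⟨s, hs1, hstrain, henv⟩ | ⟨s, hs, hstrain⟩ | ⟨θ, hθ, hosc, hhover⟩ | hloc | ⟨θ', hθ', hosc', hhover'⟩ |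
      hB8 | hB9
    · exact
        Theorems.PowerGaugeEulerLiouville.NeedleRace.selfSimilar_ae_eq_zero_of_logClockC2_past
          hρ hρh hT₁ hTT₁ x₀ h'.1 h'.2.1 h'.2.2 hu hp' hV hs₁ hclock
    · exact
        Theorems.PowerGaugeEulerLiouville.NeedleRace.selfSimilar_ae_eq_zero_of_subcriticalClockC2_past
          hρ hρh hT₁ hTT₁ x₀ h'.1 h'.2.1 h'.2.2 hu hp' hV hclock
    · exact
        Theorems.PowerGaugeEulerLiouville.NeedleRace.selfSimilar_ae_eq_zero_of_strainClockC2_past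
          hρ hρh hT₁ hTT₁ x₀ h'.1 h'.2.1 h'.2.2 hu hp' hV hs1 hstrain henv
    · exact
        Theorems.PowerGaugeEulerLiouville.NeedleRace.selfSimilar_ae_eq_zero_of_strongStrainClockC2_past
          hρ hρh hT₁ hTT₁ x₀ h'.1 h'.2.1 h'.2.2 hu hp' hV hs hstrain
    · exact
        Theorems.PowerGaugeEulerLiouville.NeedleRace.selfSimilar_ae_eq_zero_of_hoveringLawC2_past
          hρ hρh hT₁ hTT₁ x₀ h'.1 h'.2.1 h'.2.2 hu hp' hV hθ hosc hhover
    · -- v88: «one clocked ball kills»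
      exact
        Theorems.PowerGaugeEulerLiouville.NeedleRace.selfSimilar_ae_eq_zero_of_localPowerClockC2_past
          hρ hρh hT₁ hTT₁ x₀ h'.1 h'.2.1 h'.2.2 hu hp' hV hloc
    · -- v91: the hovering law at one ball (LEAD g13)
      exact
        Theorems.PowerGaugeEulerLiouville.NeedleRace.selfSimilar_ae_eq_zero_of_localHoveringLawC2_past
          hρ hρh hT₁ hTT₁ x₀ h'.1 h'.2.1 h'.2.2 hu hp' hV hθ' hosc' hhover'
    · -- v92 alt 8
      exact
        Theorems.PowerGaugeEulerLiouville.Past.selfSimilar_ae_eq_zero_of_perigeeFastEnvelopeC2_level_past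
          hρ hρh hT₁ hTT₁ x₀ h'.1 h'.2.1 h'.2.2 hu hp' hV hB8
    · -- v94 alt 9
      exact
        Theorems.PowerGaugeEulerLiouville.Past.selfSimilar_ae_eq_zero_of_spikesOrHoveringC2_profile_past
          hρ hρh hT₁ hTT₁ x₀ h'.1 h'.2.1 h'.2.2 hu hp' hV hB9
  · -- v78: C-MIN past twin
    obtain ⟨Q, p', -, hp', -, h'⟩ := Theorems.PowerGaugeEulerLiouville.PressureSlaving.inClass_pastSelfSimilarPressure (g := 1 / (2 + ρ)) (by linarith) hT₁ hTT₁ h hu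
    exact
      Theorems.PowerGaugeEulerLiouville.Condenser.selfSimilar_ae_eq_zero_of_minimalTypeGradientC2_past
        hρ hρh hT₁ hTT₁ x₀ h'.1 h'.2.1 h'.2.2 hu hp' hV hmin
  · obtain ⟨Q, p', -, hp', -, h'⟩ := Theorems.PowerGaugeEulerLiouville.PressureSlaving.inClass_pastSelfSimilarPressure (g := 1 / (2 + ρ)) (by linarith) hT₁ hTT₁ h hu
    rcases hcl with hUC | hpi
    · exact
        Theorems.PowerGaugeEulerLiouville.Past.selfSimilar_ae_eq_zero_of_uniformContinuousC2_profile
          hρ hρh hT₁ hTT₁ x₀ h'.1 h'.2.1 h'.2.2 hu hp' hV hUC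
    · exact
        Theorems.PowerGaugeEulerLiouville.Past.selfSimilar_ae_eq_zero_of_piercingBernoulliC2_profile_past
          hρ hρh hT₁ hTT₁ x₀ h'.1 h'.2.1 h'.2.2 hu hp' hV hpi
  · exact
      Theorems.PowerGaugeEulerLiouville.PastSteady.ae_eq_zero_of_gauge_of_pastHomogeneous
        hρ h.1 h.2.1 h.2.2 hT₁ hTT₁ x₀ hhom hu

/-- STUB 4e [FILLED BY NAME; fillers and credits: CENSUS-19832-vNN.md, branch comments below]. -/
theorem stub_selfSimilarEndpointPowerSpread : Sig.stub_selfSimilarEndpointPowerSpread := by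
  intro ρ _ _ u p H c V P h hss hρ hps
  subst hρ
  rcases hps with ⟨⟨δ, Cup, R₀, hδ, hδ1, hCup, hup⟩, ⟨c₀, η, hc₀, hη, hlow⟩⟩ | ⟨c₀, η, hc₀, hη, hlow⟩
  · exact
      Theorems.PowerGaugeEulerLiouville.EndpointSpread.selfSimilar_half_ae_eq_zero_of_shellLower
        h.1 h.2.1 h.2.2 hss.1 hss.2 hδ hδ1 hCup hup hc₀ hη hlow
  · exact
      Theorems.PowerGaugeEulerLiouville.EndpointSobolev.selfSimilar_half_ae_eq_zero_of_shellLower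
        h.1 h.2.1 h.2.2 hss.1 hss.2 hc₀ hη hlow

/-- STUB `stub_dssEndpointPowerSpread` [FILLED BY NAME; credits: CENSUS-vNN]. -/
theorem stub_dssEndpointPowerSpread : Sig.stub_dssEndpointPowerSpread := by
  intro ρ hρ0 _ u p H c h hρ hdss
  obtain ⟨l, hl, hu, τ₀, hτ₀, hcases⟩ := hdss
  -- DSS PRESSURE SLAVING (v58, ns-ezl-w1 g3 p635308): an exactly DSS pressure representative with the same class constant
  obtain ⟨p', hp', -, h'⟩ := Theorems.PowerGaugeEulerLiouville.DSSPressureSlaving.inClass_dssPressure (by linarith) hl h hu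
  rcases hcases with ⟨⟨δ, Cup, R₀, hδ, hδ1, hCup, hup⟩, ⟨c₀, η, hc₀, hη, hlow⟩⟩ | ⟨c₀, η, hc₀, hη, hlow⟩
  · exact
      Theorems.PowerGaugeEulerLiouville.DSSEndpointSpread.dss_half_ae_eq_zero_of_shellLower'
        hρ h'.1 h'.2.1 h'.2.2 hl hu hp' hτ₀ hδ hδ1 hCup hup hc₀ hη hlow
  · exact
      Theorems.PowerGaugeEulerLiouville.EndpointSobolev.dss_half_ae_eq_zero_of_shellLower_sharp'
        hρ h'.1 h'.2.1 h'.2.2 hl hu hp' hτ₀ hc₀ hη hlow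

/-- STUB 5c [FILLED BY NAME; fillers and credits: CENSUS-19832-vNN.md, branch comments below]. -/
theorem stub_dssCompactVorticity : Sig.stub_dssCompactVorticity := by
  intro ρ hρ _ u p H c h hdc
  obtain ⟨hcl, l, hl, hdss, hsupp⟩ := hdc
  exact
    Theorems.PowerGaugeEulerLiouville.dss_ae_eq_zero_of_compactSupport_vorticity
      hρ hl u p H c h.1 h.2.1 h.2.2 hcl hdss hsupp

/-- STUB `stub_dssClassicalTame` [FILLED BY NAME; credits: CENSUS-vNN]. -/
theorem stub_dssClassicalTame : Sig.stub_dssClassicalTame := by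
  intro ρ hρ _ u p H c h hd
  obtain ⟨hns, l, hl, hdss, hbdd, hcase⟩ := hd
  rcases hcase with hLq | ⟨hax, k, hk1, hk, hLk, m, hm, hLm⟩ | ⟨hax, hnos, m, hm, hLm⟩ | ⟨q, hq, hq3, hLq, τs, hτs, hdec⟩ |
    ⟨q, R₀, δ, hq, hR, hδ, hLq, hfar, hsmall⟩ | ⟨θ, hθ, hclock, hcoreP | hpdss, hnodes⟩ | ⟨θ, hθ, hclock, hpdss, hcount⟩ |
    ⟨hax, τ₀, hτ₀, hswirl, heta⟩ | hvfin
  rotate_right 5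
  · exact
      Theorems.PowerGaugeEulerLiouville.SimilarityBernoulli.ae_eq_zero_of_gauge_of_dss_of_clock_pointwise
        hρ h.1 h.2.1 h.2.2 hns hl hdss hbdd hθ hclock hcoreP hnodes
  · exact
      Theorems.PowerGaugeEulerLiouville.SimilarityBernoulli.ae_eq_zero_of_gauge_of_dss_of_clock'
        hρ h.1 h.2.1 h.2.2 hns hl hdss hpdss hbdd hθ hclock hnodes
  · exact
      Theorems.PowerGaugeEulerLiouville.DSSNodes.ae_eq_zero_of_gauge_of_dss_of_clock_countableNodes_noClause
        hρ h.1 h.2.1 h.2.2 hns hl hdss hpdss hbdd hθ hclock hcount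
  · exact
      Theorems.PowerGaugeEulerLiouville.DSSEtaRatchet.ae_eq_zero_of_gauge_of_axisym_dss_oneSlice
        hρ h.2.1 h.2.2 hns hax hl hdss hbdd hτ₀ hswirl heta
  · exact
      Theorems.PowerGaugeEulerLiouville.DSSVorticitySupport.ae_eq_zero_of_gauge_of_dss_finiteVorticitySupport
        hρ h.2.1 h.2.2 hns hl hdss hbdd hvfin
  · exact
      Theorems.PowerGaugeEulerLiouville.VorticityDecay.ae_eq_zero_of_gauge_of_dss_smallq
        hρ h.2.1 h.2.2 hns hl hdss hbdd hLq
  · exact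
      Theorems.PowerGaugeEulerLiouville.AxisymNoSwirl.powerGaugeEulerLiouville_axisym_dss_pow
        ρ hρ u p H c l k m h.1 h.2.1 h.2.2 hns hax hl hdss hbdd hk1 hk hLk hm hLm
  · exact
      Theorems.PowerGaugeEulerLiouville.AxisymNoSwirl.powerGaugeEulerLiouville_axisymNoSwirl_dss_pow
        ρ hρ u p H c l m h.1 h.2.1 h.2.2 hns (fun τ hτ => ⟨hax τ hτ, hnos τ hτ⟩) hl hdss hbdd hm hLm
  · exact
      Theorems.PowerGaugeEulerLiouville.VorticityDecay.ae_eq_zero_of_gauge_of_dss_gradDecay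
        hρ h.2.1 h.2.2 hns hl hdss hbdd hq hq3 hLq hτs hdec
  · exact
      Theorems.PowerGaugeEulerLiouville.VorticityDecay.ae_eq_zero_of_gauge_of_dss_vorticityDecay
        hρ h.2.1 h.2.2 hns hl hdss hbdd hq hR hδ hLq hfar hsmall

/-- STUB `stub_dssClassicalTameAnyAxis` [FILLED BY NAME, composed in-skeleton — the classical DSS tame stratum about ANY axis is EMPTY in the class: general-member class-isometry transport `ClassIsometry.ae_eq_zero_of_conj` (ns-ezl-w1 g10 p718442) ∘ the fixed-axis stub `stub_dssClassicalTame`]. -/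
theorem stub_dssClassicalTameAnyAxis : Sig.stub_dssClassicalTameAnyAxis := by
  intro ρ hρ hρh u p H c h hS
  obtain ⟨R, hS'⟩ := hS
  refine Theorems.PowerGaugeEulerLiouville.ClassIsometry.ae_eq_zero_of_conj h.1 h.2.1 h.2.2 R ?_
  intro u' p' H' hsw' hH' hg' hu' hp'
  subst hu' hp'
  exact stub_dssClassicalTame ρ hρ hρh _ _ H' c ⟨hsw', hH', hg'⟩ hS'

/-- STUB `stub_dssClassicalEnergy` [FILLED BY NAME; credits: CENSUS-vNN]. -/
theorem stub_dssClassicalEnergy : Sig.stub_dssClassicalEnergy := by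
  intro ρ hρ hρh u p H c h hd
  obtain ⟨hns, l, hl, hdss, hcase⟩ := hd
  rcases hcase with ⟨hρne, hM⟩ | ⟨K, R₀, γ, β, τ₀, hK, hR₀, hγ, hβ, hshell, hτ₀, hsub⟩
  · exact
      Theorems.PowerGaugeEulerLiouville.FiniteEnergy.powerGaugeEulerLiouville_dss_finiteEnergy
        ρ hρ hρne u p H c l h.1 h.2.1 h.2.2 hns hl hdss hM
  · exact
      Theorems.PowerGaugeEulerLiouville.CollapseEnergy.powerGaugeEulerLiouville_dss_subExtremal
        ρ hρ u p H c l K R₀ γ β τ₀ h.1 h.2.1 h.2.2 hρh hns hl hdss hK hR₀ hγ hβ hshell hτ₀ hsub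

/-- STUB 5f [FILLED BY NAME; fillers and credits: CENSUS-19832-vNN.md, branch comments below]. -/
theorem stub_weakFluxTame : Sig.stub_weakFluxTame := by
  intro ρ hρ _ u p H c h hw
  rcases hw with hflux | hout | ⟨P, hP, hper⟩
  · exact
      Theorems.PowerGaugeEulerLiouville.powerGaugeEulerLiouville_finiteBackwardFlux
        ρ hρ u p H c h.1 h.2.1 h.2.2 hflux
  · exact
      Theorems.PowerGaugeEulerLiouville.powerGaugeEulerLiouville_of_outgoingFlux
        hρ h.1 h.2.1 h.2.2 hout
  · exact
      Theorems.PowerGaugeEulerLiouville.ae_eq_zero_of_gauge_of_periodicGradient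
        (by linarith : (-1 : ℝ) < ρ) h.2.1 h.2.2 hP hper

/-- STUB `stub_smallTypeIGradient` [FILLED BY NAME; credits: CENSUS-vNN]. -/
theorem stub_smallTypeIGradient : Sig.stub_smallTypeIGradient := by
  intro ρ hρ hρh u p H c h hst
  rcases hst with ⟨T₁, hT₁, hpast⟩ | ⟨T₁, Λ, hT₁, hcl, hΛc, hΛ, hborn⟩ | ⟨T₁, hT₁, hcl, ⟨K', hK'⟩, ⟨K, T₀, hK1, hK⟩ | ⟨K, hK1, hS⟩⟩
  · exact
      Theorems.PowerGaugeEulerLiouville.PastIrrotational.ae_eq_zero_of_gauge_of_pastIrrotational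
        hρ hρh h.1 h.2.1 h.2.2 hT₁ (fun τ hτ => (hpast τ hτ).1) (fun τ hτ => (hpast τ hτ).2.1) (fun τ hτ => (hpast τ hτ).2.2)
  · exact
      Theorems.PowerGaugeEulerLiouville.VorticityBirth.ae_eq_zero_of_gauge_of_vanishingBornVorticity
        hρ hρh h.1 h.2.1 h.2.2 hT₁ hcl hΛc hΛ hborn
  · exact
      Theorems.PowerGaugeEulerLiouville.PastKelvin.ae_eq_zero_of_gauge_of_pastEventuallySmallTypeI
        hρ hρh h.1 h.2.1 h.2.2 hT₁ hcl hK' hK1 hK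
  · exact
      Theorems.PowerGaugeEulerLiouville.PastKelvin.ae_eq_zero_of_gauge_of_pastSubunitVortexStretching
        hρ hρh h.1 h.2.1 h.2.2 hT₁ hcl hK' hK1 hS

/-- STUB `stub_symmetricWeak` [FILLED BY NAME; credits: CENSUS-vNN]. -/
theorem stub_symmetricWeak : Sig.stub_symmetricWeak := by
  intro ρ hρ _ u p H c h hsym
  rcases hsym with ⟨P, hP, hper⟩ | ⟨U, G₀, b, hu, hHb⟩ | ⟨L, y₀, w, hw, hLw, hscrew⟩
  · exact
      Theorems.PowerGaugeEulerLiouville.TimePeriodic.powerGaugeEulerLiouville_timePeriodic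
        ρ hρ u p H c P hP hper h.1 h.2.1 h.2.2
  · obtain ⟨h1, h2, h3⟩ := h
    subst hu hHb
    exact
      Theorems.PowerGaugeEulerLiouville.TravelingWave.powerGaugeEulerLiouville_travelingWave
        ρ hρ U p G₀ c b h1 h2 h3
  · exact
      Theorems.PowerGaugeEulerLiouville.ScrewSymmetric.powerGaugeEulerLiouville_screwSymmetric
        ρ hρ u p H c L y₀ w hw hLw hscrew h.1 h.2.1 h.2.2

/-- STUB `stub_pastSelfSimilarSubExtremal` [FILLED BY NAME; credits: CENSUS-vNN]. -/
theorem stub_pastSelfSimilarSubExtremal : Sig.stub_pastSelfSimilarSubExtremal := by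
  intro ρ hρ hρh u p H c h hps
  rcases hps with ⟨T, T₁, x₀, V, hT₁, hTT₁, hu, hsub⟩ | ⟨T, T₁, x₀, V, q, R₀, hT₁, hTT₁, hu, hρ2, hq2, hq, hVq⟩ |
    ⟨T, T₁, x₀, V, G, R₀, hT₁, hTT₁, hu, hρ2, hVG, hsymm⟩ | ⟨T, T₁, x₀, V, R₀, hT₁, hTT₁, hu, hρ2, hirr⟩ | ⟨T, T₁, x₀, V, G, hT₁, hTT₁, hu, hρ2, hVG, hω1, hω2⟩
  · obtain ⟨Q, p', -, hp', -, h'⟩ := Theorems.PowerGaugeEulerLiouville.PressureSlaving.inClass_pastSelfSimilarPressure (g := 1 / (2 + ρ)) (by linarith) hT₁ hTT₁ h hu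
    exact
      Theorems.PowerGaugeEulerLiouville.Past.selfSimilar_ae_eq_zero_of_subExtremal_past
        hρ hρh hT₁ hTT₁ x₀ h'.1 h'.2.1 h'.2.2 hu hp' hsub
  · obtain ⟨Q, p', -, hp', -, h'⟩ := Theorems.PowerGaugeEulerLiouville.PressureSlaving.inClass_pastSelfSimilarPressure (g := 1 / (2 + ρ)) (by linarith) hT₁ hTT₁ h hu
    exact
      Theorems.PowerGaugeEulerLiouville.LpProfile.selfSimilar_ae_eq_zero_of_memLp_profile_past
        hρ hρ2 hT₁ hTT₁ x₀ h'.1 h'.2.1 h'.2.2 hu hp' hq2 hq hVq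
  · obtain ⟨Q, p', -, hp', -, h'⟩ := Theorems.PowerGaugeEulerLiouville.PressureSlaving.inClass_pastSelfSimilarPressure (g := 1 / (2 + ρ)) (by linarith) hT₁ hTT₁ h hu
    exact
      Theorems.PowerGaugeEulerLiouville.WeakConfinedVorticity.selfSimilar_ae_eq_zero_of_confinedCurl_profile_past
        hρ hρ2 hT₁ hTT₁ x₀ h'.1 h'.2.1 h'.2.2 hu hp' hVG hsymm
  · obtain ⟨Q, p', -, hp', -, h'⟩ := Theorems.PowerGaugeEulerLiouville.PressureSlaving.inClass_pastSelfSimilarPressure (g := 1 / (2 + ρ)) (by linarith) hT₁ hTT₁ h hu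
    exact
      Theorems.PowerGaugeEulerLiouville.WeakConfinedVorticity.selfSimilar_ae_eq_zero_of_weaklyIrrotationalFar_profile_past
        hρ hρ2 hT₁ hTT₁ x₀ h'.1 h'.2.1 h'.2.2 hu hp' hirr
  · obtain ⟨Q, p', -, hp', -, h'⟩ := Theorems.PowerGaugeEulerLiouville.PressureSlaving.inClass_pastSelfSimilarPressure (g := 1 / (2 + ρ)) (by linarith) hT₁ hTT₁ h hu
    exact
      Theorems.PowerGaugeEulerLiouville.WeakConfinedVorticity.selfSimilar_ae_eq_zero_of_integrableCurl_profile_past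
        hρ hρ2 hT₁ hTT₁ x₀ h'.1 h'.2.1 h'.2.2 hu hp' hVG hω1 hω2

/-- STUB `stub_pastSpiralSubExtremal` [FILLED BY NAME — the sub-extremal SPIRAL stratum is EMPTY in the class: member `Spiral.pastSpiralSubExtremal_trivial` (R3a spiral dictionary P2–P7 of line `relative_equilibria` ∘ Bronzi–Shvydkoy radial endgame; hands ns-idea-11, ns-ezl-w1/w2/w3, ns-sfl-p1; CENSUS-v118)]. -/
theorem stub_pastSpiralSubExtremal : Sig.stub_pastSpiralSubExtremal := by
  intro ρ hρ hρh u p H c h hS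
  exact Theorems.PowerGaugeEulerLiouville.Spiral.pastSpiralSubExtremal_trivial hρ hρh h hS

/-- STUB `stub_pastSpiralTameWeak` [FILLED BY NAME — the regularity-free SPIRAL strata (`L^q` tail / confined weak curl / weakly irrotational far field / integrable curl) are EMPTY in the class: member `Spiral.pastSpiralTameWeak_trivial` (ns-ezl-w3 g9; profile-level reductions ∘ spiral dictionary p727126 ∘ radial endgame p724254; CENSUS-v119)]. -/
theorem stub_pastSpiralTameWeak : Sig.stub_pastSpiralTameWeak := by
  intro ρ hρ hρh u p H c h hS
  exact Theorems.PowerGaugeEulerLiouville.Spiral.pastSpiralTameWeak_trivial hρ hρh h hS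

/-- STUB `stub_shapeFastClock` [FILLED BY NAME; credits: CENSUS-vNN]. -/
theorem stub_shapeFastClock : Sig.stub_shapeFastClock := by
  intro ρ hρ hρh u p H c h hsh
  rcases hsh with ⟨T₁, c', V, hT₁, hc', hu⟩ | ⟨T₁, T₀, g, V, hT₁, hT₀, hg, hu⟩ | ⟨g, V, hg, hu⟩ |
    ⟨T₁, T₀, g, V, _hT₁, hT₀, hg, hu, hWE⟩ | ⟨hρ12, T₁, T₀, g, V, hT₁, hT₀, hg, hu⟩
  · exact
      Theorems.PowerGaugeEulerLiouville.PastShape.ae_eq_zero_of_gauge_of_pastExpandingBreather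
        hρ hρh h.1 h.2.1 h.2.2 hT₁ hc' hu
  · exact
      Theorems.PowerGaugeEulerLiouville.PastShape.ae_eq_zero_of_gauge_of_pastFastPowerClock
        hρ hρh h.1 h.2.1 h.2.2 hT₁ hT₀ hg hu
  · exact
      Theorems.PowerGaugeEulerLiouville.PastShape.ae_eq_zero_of_gauge_of_slowPowerClock
        hρ hρh h.1 h.2.1 h.2.2 hg hu
  · exact
      Theorems.PowerGaugeEulerLiouville.PowerClock.ae_eq_zero_of_gauge_of_finiteEnergySlowClock
        hρ.le h.1 h.2.1 h.2.2 hT₀ hg hu hWE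
  · subst hρ12
    exact
      Theorems.PowerGaugeEulerLiouville.PowerClock.ae_eq_zero_of_gauge_half_of_clock_ne
        h.1 h.2.1 h.2.2 hT₁ hT₀ hg hu

/-- STUB `stub_swirlFreeDrifting` [FILLED BY NAME; credits: CENSUS-vNN]. -/
theorem stub_swirlFreeDrifting : Sig.stub_swirlFreeDrifting := by
  intro ρ hρ hρh u p H c h hS
  have h6 : 6 / (6 + ρ) < 1 := by
    rw [div_lt_one (by linarith)]
    linarith
  have h0 : 0 < 6 / (6 + ρ) := by positivity
  exact
    Theorems.PowerGaugeEulerLiouville.SwirlfreeLedger.ledgerEndgame_of_classical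
      ρ hρ hρh u p H c h hS.1
      ⟨(6 / (6 + ρ) + 1) / 2, by linarith, by linarith,
        Theorems.PowerGaugeEulerLiouville.SwirlfreeLedger.axisLedgerDecay_of_classical
          ρ hρ hρh u p H c h hS.1 _ (by linarith) (by linarith),
        Theorems.PowerGaugeEulerLiouville.SwirlfreeLedger.materialConfinement_of_swirlFreeDrifting
          u p hS _ (by linarith)⟩

/-- STUB `stub_bernoulliClockedCore` [FILLED BY NAME; credits: CENSUS-vNN]. -/
theorem stub_bernoulliClockedCore : Sig.stub_bernoulliClockedCore := by
  intro ρ hρ _hρh u p H c h hS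
  obtain ⟨Λ, n, θ, hcl, hΛc, hΛ, hn0, hn, hθ, hclock, hcore, hpier⟩ := hS
  exact
    Theorems.PowerGaugeEulerLiouville.SimilarityBernoulli.ae_eq_zero_of_gauge_of_piercing_of_clock_along
      hρ h.1 h.2.1 h.2.2 hcl hΛc hΛ hn0 hn hθ hclock hcore hpier

/-- STUB `stub_helicalTubePast` [FILLED BY NAME; credits: CENSUS-vNN]. -/
theorem stub_helicalTubePast : Sig.stub_helicalTubePast := by
  -- FRAME RECEIPT (v116): `IsHelicalTubePast ρ` is O(3)-invariant — `ClassIsometry.exists_helicalTubePast_conj_iff` (ns-ezl-w2 g8 p720464).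
  intro ρ hρ hρh u p H c h hS
  exact
    Theorems.PowerGaugeEulerLiouville.HelicityTube.ae_eq_zero_of_gauge_of_helicalTubePast_free hρ hρh h.1 h.2.1 h.2.2 hS

/-- STUB `stub_chiralTubePast` [FILLED BY NAME — the chiral-tube stratum is EMPTY in the class: member `ChiralAnchor.stub_anchorRace_filler ∘ (shellHelicityFloor, farVolumeBound, stub_anchorFlow_filler)` (K4 ∘ K2 ∘ K3 ∘ K1, line chiral_anchor)]. -/
theorem stub_chiralTubePast : Sig.stub_chiralTubePast := by
  -- FRAME RECEIPT (v116): `IsChiralTubePast` is O(3)-invariant — `ClassIsometry.exists_chiralTubePast_conj_iff` (ns-ezl-w2 g8 p720464); this binder denies every frame and both chiralities.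
  intro ρ hρ hρh u p H c h hS
  -- K4 race (ns-ezl-w3 g8 `ChiralAnchor.stub_anchorRace_filler`, p716554) ∘ K2 shell helicity floor + K3 far-volume bound (proofs ns-idea-11, Theorems ports ns-ezl-w1 g9 p713294 / p713697) ∘ K1 anchor flows (ns-ezl-w3 g8 p711242)
  exact (Theorems.PowerGaugeEulerLiouville.ChiralAnchor.stub_anchorRace_filler
    Theorems.PowerGaugeEulerLiouville.ChiralAnchor.shellHelicityFloor Theorems.PowerGaugeEulerLiouville.ChiralAnchor.farVolumeBound
    ρ hρ u p H c h hS (Theorems.PowerGaugeEulerLiouville.ChiralAnchor.stub_anchorFlow_filler u p hS.1)).elim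

/-- STUB `stub_stretchingBudgeted` [FILLED BY NAME; credits: CENSUS-vNN]. -/
theorem stub_stretchingBudgeted : Sig.stub_stretchingBudgeted := by
  intro ρ hρ hρh u p H c h hS
  exact
    Theorems.PowerGaugeEulerLiouville.StretchingBudget.ae_eq_zero_of_gauge_of_stretchingBudgeted_free hρ hρh h.1 h.2.1 h.2.2 hS

/-- STUB `stub_anchoredBudgeted` [FILLED BY NAME; credits: CENSUS-vNN]. -/
theorem stub_anchoredBudgeted : Sig.stub_anchoredBudgeted := by
  intro ρ hρ _hρh u p H c h hS
  exact
    Theorems.PowerGaugeEulerLiouville.AnchoredBudget.anchoredBudgeted_ae_eq_zero_rev3 ρ hρ u p H c h hS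

/-- STUB `stub_confinedVortex` [FILLED BY NAME; credits: CENSUS-vNN]. -/
theorem stub_confinedVortex : Sig.stub_confinedVortex := by
  intro ρ hρ _ u p H c h hv
  obtain ⟨hcl, κ, β, hκ, hβ, hβρ, hsupp⟩ := hv
  have hωc : ∀ τ : ℝ, τ < 0 → HasCompactSupport (Literature.Analysis.FluidPDE.curl (u τ)) := fun τ hτ =>
    IsCompact.of_isClosed_subset (isCompact_closedBall (0 : E3) _) (isClosed_tsupport _)
      (closure_minimal ((hsupp τ hτ).trans Metric.ball_subset_closedBall) Metric.isClosed_closedBall)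
  have hrepr : ∀ τ : ℝ, τ < 0 → u τ = Literature.Analysis.FluidPDE.biotSavart (Literature.Analysis.FluidPDE.curl (u τ)) :=
    fun τ hτ =>
      Theorems.PowerGaugeEulerLiouville.CompactVortex.slice_eq_biotSavart_curl
        hρ.le h.2.2 hcl hτ (hωc τ hτ)
  have hSB :=
    Theorems.PowerGaugeEulerLiouville.CompactVortex.slabBounds_of_biotSavart
      hcl hκ hβ hsupp hrepr
  obtain ⟨C, hC⟩ :=
    Theorems.PowerGaugeEulerLiouville.CompactVortex.vortexVolumeEnergyIneq
  exact
    Theorems.PowerGaugeEulerLiouville.CompactVortex.ae_eq_zero_of_gauge_of_confinedVortex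
      hρ h.1 h.2.1 h.2.2 hcl hκ hβ hβρ hsupp hrepr hSB hC

/-- STUB `stub_fadingTamePast` [FILLED BY NAME; credits: CENSUS-vNN]. -/
theorem stub_fadingTamePast : Sig.stub_fadingTamePast := by
  intro ρ hρ hρh u p H c h hf
  rcases hf with ⟨T₁, c', M, C, ε, x₀, hT₁, hc', hε, hcl, hvel, hgrad⟩ | ⟨T₁, T₀, M, m, K, x₀, hT₁, hT, hm, hcl, hvel, hK, hgrad⟩ |
    ⟨T₁, c', M, C, D, k, hT₁, hc', hkc, hcl, hvel, hgrad, hcurl⟩ | ⟨T₁, T, μ, g, B, hT₁, hT, hcl, hμ, hg, hsym, hB, htame⟩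
  rotate_right
  · exact
      Theorems.PowerGaugeEulerLiouville.NegRateDiscreteClock.ae_eq_zero_of_gauge_of_tame
        hρ hρh h.1 h.2.1 h.2.2 hT₁ hT hcl hμ hg hsym hB htame
  · exact
      Theorems.PowerGaugeEulerLiouville.FadingPast.ae_eq_zero_of_gauge_of_fadingMildPast_shifted
        hρ hρh h.1 h.2.1 h.2.2 hT₁ hcl hc' hε x₀ hvel hgrad
  · exact
      Theorems.PowerGaugeEulerLiouville.FadingPowerPast.ae_eq_zero_of_gauge_of_fadingPowerPast_shifted
        hρ hρh h.1 h.2.1 h.2.2 hT₁ hT hcl hm x₀ hvel hK hgrad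
  · exact
      Theorems.PowerGaugeEulerLiouville.FadingSteepPast.ae_eq_zero_of_gauge_of_fadingSteepVorticityPast
        hρ hρh h.1 h.2.1 h.2.2 hT₁ hcl hc' hvel hgrad hcurl hkc

/-- STUB `stub_pastFrozenDirection` [FILLED BY NAME; credits: CENSUS-vNN]. -/
theorem stub_pastFrozenDirection : Sig.stub_pastFrozenDirection := by
  intro ρ hρ _ u p H c h hF
  obtain ⟨T₁, hT₁, e, he, hfro⟩ := hF
  exact
    Theorems.PowerGaugeEulerLiouville.FrozenDirection.ae_eq_zero_of_gauge_of_pastFrozenDirection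
      hρ h.1 h.2.1 h.2.2 hT₁ he hfro

/-- STUB 5c [FILLED BY NAME; fillers and credits: CENSUS-19832-vNN.md, branch comments below]. -/
theorem stub_tameShapePreserving : Sig.stub_tameShapePreserving := by
  intro ρ hρ hρh u p H c h hts
  obtain ⟨hcl, hshape, hpow⟩ := hts
  rcases
    Theorems.PowerGaugeEulerLiouville.ClockRigidity.clockRigidity_of_classical_shapePreserving
      hρ hρh h.2.1 h.2.2 hcl hshape with ⟨c', W, hc', hW⟩ | ⟨T₀, g, W, hT₀, hW⟩ | ⟨v, hv⟩
  · exact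
      Theorems.PowerGaugeEulerLiouville.BreatherRigidity.ae_eq_zero_of_gauge_of_classicalBreather
        hρ hρh h.2.1 h.2.2 hcl hc' hW
  · rcases hpow T₀ g W hT₀ hW with hlt | hgt | ⟨hslow, hT₀0⟩
    · exact
        Theorems.PowerGaugeEulerLiouville.PowerClockRigidity.ae_eq_zero_of_gauge_of_classicalPowerClock_offWindow
          hρ hρh h.1 h.2.1 h.2.2 hcl hT₀ (Or.inl hlt) hW
    · exact
        Theorems.PowerGaugeEulerLiouville.PowerClockRigidity.ae_eq_zero_of_gauge_of_classicalPowerClock_offWindow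
          hρ hρh h.1 h.2.1 h.2.2 hcl hT₀ (Or.inr hgt) hW
    · subst hT₀0
      exact
        Theorems.PowerGaugeEulerLiouville.PastShape.ae_eq_zero_of_gauge_of_slowPowerClock
          hρ hρh h.1 h.2.1 h.2.2 hslow (fun τ hτ y => by simpa using hW τ hτ y)
  · exact
      Theorems.PowerGaugeEulerLiouville.PastSteady.ae_eq_zero_of_gauge_of_pastSteady
        hρ h.1 h.2.1 h.2.2 le_rfl hv

/-- STUB `stub_oneSidedPressurePast` [FILLED BY NAME; credits: CENSUS-vNN]. -/
theorem stub_oneSidedPressurePast : Sig.stub_oneSidedPressurePast := by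
  intro ρ hρ hρh u p H c h h1
  obtain ⟨T₁, hone⟩ := h1
  exact
    Theorems.PowerGaugeEulerLiouville.PressureFloor.ae_eq_zero_of_gauge_of_pastSlicewiseOneSided
      hρ hρh h.1 h.2.1 h.2.2
      Theorems.PowerGaugeEulerLiouville.PressureFloor.newtonianBumps (T₁ := T₁) hone

/-- STUB 2x [FILLED BY NAME — `ExtinctTrace.extinctIdentity`; fillers and credits: CENSUS-19832-vNN.md, branch comments below]. -/
theorem stub_extinctConservative : Sig.stub_extinctConservative := by
  intro ρ _ hρh u p H c h hx
  obtain ⟨hρ29, hext, ⟨hflux, hcons⟩ | hL4⟩ := hx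
  · exact
      Theorems.PowerGaugeEulerLiouville.ExtinctTrace.extinctIdentity ρ hρ29 hρh u p H c ⟨h.1, h.2.1, h.2.2⟩ hflux ⟨hcons, hext⟩
  · -- v80: no L⁴-integrable Euler collapse into rest
    exact
      Theorems.PowerGaugeEulerLiouville.ExtinctTrace.ae_eq_zero_of_memL4Loc_of_energyExtinct ρ hρ29 hρh u p H c ⟨h.1, h.2.1, h.2.2⟩ hL4 hext

/-- STUB `stub_swirlFreeSlowDrifting` [FILLED BY NAME; credits: CENSUS-vNN]. -/
theorem stub_swirlFreeSlowDrifting : Sig.stub_swirlFreeSlowDrifting := by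
  intro ρ hρ hρh u p H c h hS
  obtain ⟨M, κ, hκ, hW⟩ := hS
  exact
    Theorems.PowerGaugeEulerLiouville.CasimirFloor.vanishesAE_of_casimirFloor_of_blobsPersist
      Theorems.PowerGaugeEulerLiouville.CasimirFloor.casimirFloor
      ρ hρ hρh u p H c h M κ hκ hW
      (Theorems.PowerGaugeEulerLiouville.CasimirFloor.ledgerBlobsPersist_of_swirlFreeDriftingWith
        u p M κ hW)

/-- STUB `stub_mirrorOutgoing` [FILLED BY NAME; credits: CENSUS-vNN]. -/
theorem stub_mirrorOutgoing : Sig.stub_mirrorOutgoing := by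
  intro ρ hρ hρh u p H c h hmo
  exact
    Theorems.PowerGaugeEulerLiouville.MirrorMoment.mirrorOutgoing_ae_eq_zero ρ hρ hρh u p H c h hmo

/-- STUB `stub_slabBoundedSwirlFree` [FILLED BY NAME — the slab-bounded swirl-free stratum is EMPTY in the class: member `CasimirHaul.slabBoundedSwirlFree_trivial` (line casimir_haul, H4 ∘ H3 ∘ H2 ∘ H1)]. -/
theorem stub_slabBoundedSwirlFree : Sig.stub_slabBoundedSwirlFree := by
  intro ρ hρ hρh u p H c h hS
  exact Theorems.PowerGaugeEulerLiouville.CasimirHaul.slabBoundedSwirlFree_trivial hρ hρh h hS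

/-- STUB `stub_slabBoundedSwirlFreeAnyAxis` [FILLED BY NAME — the slab-bounded swirl-free stratum about ANY axis is EMPTY in the class: member `CasimirHaul.slabBoundedSwirlFree_trivial_anyAxis` (ns-ezl-w1 g10) = class-isometry transport p718442 ∘ casimir member p718198]. -/
theorem stub_slabBoundedSwirlFreeAnyAxis : Sig.stub_slabBoundedSwirlFreeAnyAxis := by
  intro ρ hρ hρh u p H c h hS
  obtain ⟨R, hS'⟩ := hS
  exact Theorems.PowerGaugeEulerLiouville.CasimirHaul.slabBoundedSwirlFree_trivial_anyAxis hρ hρh h R hS'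

/-- STUB `stub_axisymSlowDrifting` [FILLED BY NAME; credits: CENSUS-vNN]. -/
theorem stub_axisymSlowDrifting : Sig.stub_axisymSlowDrifting := by
  intro ρ hρ hρh u p H c h hS
  exact
    Theorems.PowerGaugeEulerLiouville.AxisymSlowDrifting.ae_eq_zero_of_gauge_of_axisymSlowDrifting'
      hρ hρh h.1 h.2.1 h.2.2 hS

/-- STUB `stub_axisymSlowDriftingAnyAxis` [FILLED BY NAME — the axisymmetric slow-drifting stratum about ANY axis is EMPTY in the class: member `AxisymSlowDrifting.ae_eq_zero_of_gauge_of_axisymSlowDrifting_anyAxis` (ns-ezl-w1 g10 p719063) = class-isometry transport p718442 ∘ `stub_axisymSlowDrifting`'s member]. -/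
theorem stub_axisymSlowDriftingAnyAxis : Sig.stub_axisymSlowDriftingAnyAxis := by
  intro ρ hρ hρh u p H c h hS
  obtain ⟨R, hS'⟩ := hS
  exact Theorems.PowerGaugeEulerLiouville.AxisymSlowDrifting.ae_eq_zero_of_gauge_of_axisymSlowDrifting_anyAxis hρ hρh h.1 h.2.1 h.2.2 R hS'

/-- STUB `stub_tameBreather` [FILLED BY NAME; credits: CENSUS-vNN]. -/
theorem stub_tameBreather : Sig.stub_tameBreather := by
  intro ρ hρ hρh u p H c h hB
  rcases hB with ⟨hcl, c', V, hc', hbr⟩ | ⟨-, T₁, c', V, hT₁, hc', hbr⟩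
  · exact
      Theorems.PowerGaugeEulerLiouville.BreatherRigidity.ae_eq_zero_of_gauge_of_classicalBreather
        hρ hρh h.2.1 h.2.2 hcl hc' hbr
  · exact
      Theorems.PowerGaugeEulerLiouville.BreatherWeak.ae_eq_zero_of_gauge_of_pastBreather
        hρ hρh h.1 h.2.1 h.2.2 hT₁ hc' hbr

/-- STUB `stub_discreteBreather` [FILLED BY NAME; credits: CENSUS-vNN]. -/
theorem stub_discreteBreather : Sig.stub_discreteBreather := by
  intro ρ hρ hρh u p H c h hD
  rcases hD with ⟨T₁, P₀, Λ, hT₁, hP₀, hΛ0, hΛ1, hu⟩ | ⟨T₁, P₀, Λ, α, β, E₀, hP₀, hΛ, hu, hαβ, hβ, hE⟩ |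
    ⟨hρ12, T₁, P₀, Λ, hT₁, hP₀, hΛ0, hΛ1, hu⟩
  · exact
      Theorems.PowerGaugeEulerLiouville.DiscreteBreather.ae_eq_zero_of_gauge_of_expanding
        hρ.le h.1 h.2.1 h.2.2 hT₁ hP₀ hΛ0 hΛ1 hu
  · exact
      Theorems.PowerGaugeEulerLiouville.DiscreteBreather.ae_eq_zero_of_gauge_of_contracting_of_energyBound
        hρ.le h.1 h.2.1 h.2.2 hP₀ hΛ hu hαβ hβ hE
  · subst hρ12
    exact
      Theorems.PowerGaugeEulerLiouville.DiscreteBreather.ae_eq_zero_of_gauge_half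
        h.1 h.2.1 h.2.2 hT₁ hP₀ hΛ0 hΛ1 hu

/-- STUB `stub_discreteClock` [FILLED BY NAME; credits: CENSUS-vNN]. -/
theorem stub_discreteClock : Sig.stub_discreteClock := by
  intro ρ hρ hρh u p H c h hD
  obtain ⟨T, g, hT, hu, hcase⟩ := hD
  rcases hcase with hg | hg | ⟨hg, α, β, E₀, hαβ, hβ, hE⟩ | ⟨hρ12, hg⟩
  · exact
      Theorems.PowerGaugeEulerLiouville.DiscreteClock.ae_eq_zero_of_gauge_of_fast
        hρ.le hρh h.1 h.2.1 h.2.2 hT hg hu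
  · exact
      Theorems.PowerGaugeEulerLiouville.DiscreteClock.ae_eq_zero_of_gauge_of_slow
        hρ.le h.1 h.2.1 h.2.2 hT hg hu
  · exact
      Theorems.PowerGaugeEulerLiouville.DiscreteClock.ae_eq_zero_of_gauge_of_slow_of_energyBound
        hρ.le h.1 h.2.1 h.2.2 hT hg hu hαβ hβ hE
  · subst hρ12
    exact
      Theorems.PowerGaugeEulerLiouville.DiscreteClock.ae_eq_zero_of_gauge_half
        h.1 h.2.1 h.2.2 hT hg hu

/-- STUB `stub_offRateSelfSimilar` [FILLED BY NAME; credits: CENSUS-vNN]. -/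
theorem stub_offRateSelfSimilar : Sig.stub_offRateSelfSimilar := by
  intro ρ hρ hρh u p H c h hoff
  rcases hoff with ⟨g, W, hg, hu⟩ | ⟨T, T₁, x₀, g, W, hT₁, hTT₁, hgw, hu⟩
  · -- ORIGIN PRESSURE SLAVING (ns-ezl-w3 g2 p630961)
    obtain ⟨Q, -, -, h'⟩ := Theorems.PowerGaugeEulerLiouville.PressureSlaving.inClass_selfSimilarPressure (by linarith) h hu
    exact
      Theorems.PowerGaugeEulerLiouville.OffRate.selfSimilar_ae_eq_zero_of_rate_ne
        hρ hρh h'.1 h'.2.1 h'.2.2 hg hu (fun τ _ => rfl)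
  · -- PAST PRESSURE SLAVING (ns-ezl-w3 g2 p635404), any rate `g`
    obtain ⟨Q, p', -, hp, -, h'⟩ := Theorems.PowerGaugeEulerLiouville.PressureSlaving.inClass_pastSelfSimilarPressure (g := g) (by linarith) hT₁ hTT₁ h hu
    rcases hgw with hg25 | ⟨hg1, hg2⟩ | ⟨hg0, hg21, hsub⟩
    rotate_right
    · exact
        Theorems.PowerGaugeEulerLiouville.SlowClock.selfSimilar_ae_eq_zero_of_ownRate_subExtremal_past
          hρ hρh hT₁ hTT₁ x₀ h'.1 h'.2.1 h'.2.2 hg0 hg21 hu hp hsub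
    · rcases lt_trichotomy g 0 with hneg | hzero | hpos
      · exact
          Theorems.PowerGaugeEulerLiouville.NegClock.selfSimilar_ae_eq_zero_of_neg_rate_past
            hρ hρh hT₁ hTT₁ x₀ h'.1 h'.2.1 h'.2.2 hneg hu hp
      · subst hzero
        exact
          Theorems.PowerGaugeEulerLiouville.SlowClock.separable_ae_eq_zero_past
            hρ hρh hT₁ hTT₁ x₀ h'.1 h'.2.1 h'.2.2 hu hp
      · exact
          Theorems.PowerGaugeEulerLiouville.SlowClock.selfSimilar_ae_eq_zero_of_slow_rate_past
            hρ hρh hT₁ hTT₁ x₀ h'.1 h'.2.1 h'.2.2 hpos hg25 hu hp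
    · exact
        Theorems.PowerGaugeEulerLiouville.OffRate.selfSimilar_ae_eq_zero_of_rate_window_past
          hρ hρh hT₁ hTT₁ x₀ h'.1 h'.2.1 h'.2.2 hg1 hg2 hu hp

/-- STUB `stub_selfSimilarKinematicTame` [FILLED BY NAME; credits: CENSUS-vNN]. -/
theorem stub_selfSimilarKinematicTame : Sig.stub_selfSimilarKinematicTame := by
  intro ρ hρ hρh u p H c V P h hss hV hkt
  rcases hkt with ⟨κ, q, K, R₀, hκ, hκγ, hq, hK, hcore⟩ | ⟨K, B, σ, hB, hσ0, hσ, hgrad⟩ | hmin | hgap | hfin |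
    ⟨q, ℓ, G, hq, hℓ, hsep, hG1, henv, hdiv⟩ | hsp | hrun | hrunF | hrunB | hridge | hfat | hLq | hsub
  · exact
      Theorems.PowerGaugeEulerLiouville.NeedleCorePersistence.selfSimilar_ae_eq_zero_of_corePersistence
        hρ hρh h.1 h.2.1 h.2.2 hss.1 hss.2 hV hκ hκγ hq hK hcore
  · exact
      Theorems.PowerGaugeEulerLiouville.NeedleSphereGrowth.selfSimilar_ae_eq_zero_of_expGradient
        hρ hρh h.1 h.2.1 h.2.2 hss.1 hss.2 hV hB hσ0 hσ hgrad
  · -- ★ v77: ROUND-42 THEOREM B as a binder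
    exact
      Theorems.PowerGaugeEulerLiouville.Condenser.selfSimilar_ae_eq_zero_of_minimalTypeGradientC2
        hρ hρh h.1 h.2.1 h.2.2 hss.1 hss.2 hV hmin
  · -- v82: THEOREM K «the explicit gap»
    exact
      Theorems.PowerGaugeEulerLiouville.Condenser.selfSimilar_ae_eq_zero_of_smallTypeGradientC2
        hρ hρh h.1 h.2.1 h.2.2 hss.1 hss.2 hV hgap
  · -- v96 alt 5: THEOREM B with every constant (LEAD g14 own brick #1, o-form of the E-budget)
    exact
      Theorems.PowerGaugeEulerLiouville.Condenser.selfSimilar_ae_eq_zero_of_finiteTypeGradientC2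
        hρ hρh h.1 h.2.1 h.2.2 hss.1 hss.2 hV hfin
  · -- v97 alt 6: K^Σ′ non-summable window type (nsreg-p2 R47 §5b; sfl-p1 p684892 ∘ ezl-w2 W4′/W4); c = 0 is sub-extremal
    by_cases hc0 : (0 : ℝ) < (c : ℝ)
    · exact
        Theorems.PowerGaugeEulerLiouville.Condenser.selfSimilar_ae_eq_zero_of_windowDivergentC2_of
          Theorems.PowerGaugeEulerLiouville.Condenser.weightedWindowBudget Theorems.PowerGaugeEulerLiouville.Condenser.windowSummation
          hρ hρh hc0 h.1 h.2.1 h.2.2 hss.1 hss.2 hV hq hℓ hsep hG1 henv hdiv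
    · have hc' : (c : ℝ≥0∞) = 0 := by
        have : (c : ℝ) = 0 := le_antisymm (not_lt.1 hc0) c.2
        exact_mod_cast this
      refine Theorems.PowerGaugeEulerLiouville.EnergySaturation.selfSimilar_ae_eq_zero_of_subExtremal hρ (by linarith) h.1 h.2.1 h.2.2 hss.1 hss.2 ?_
      intro ε hε L₀
      obtain ⟨hA', -⟩ :=
        Theorems.PowerGaugeEulerLiouville.NeedleThinCore.selfSimilar_needle_inputs hρ (by linarith) h.1 h.2.1 h.2.2 hss.1 hss.2 (hV.of_le one_le_two)
      refine ⟨max L₀ 1, le_max_left _ _, ?_⟩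
      have hL : (0 : ℝ) < max L₀ 1 := lt_of_lt_of_le one_pos (le_max_right _ _)
      have h0 : ∫ y in Metric.ball (0 : E3) (max L₀ 1), ‖V y‖ ^ 2 ≤ 0 :=
        Theorems.PowerGaugeEulerLiouville.Condenser.setIntegral_sq_le_of_lintegral hV.continuous le_rfl
          ((hA' _ hL).trans (by rw [hc', zero_mul, ENNReal.ofReal_zero]))
      have h1 : 0 ≤ (max L₀ 1) ^ (2 * ρ - 1) := Real.rpow_nonneg hL.le _
      nlinarith [mul_nonneg h1 (le_refl (0:ℝ)), mul_le_mul_of_nonneg_left h0 h1]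
  · -- v98 alt 7: K-SPIKE critical spikes (ns-sfl-p1 g7 p686203 ∘ last_exit LE1/LE2a/LE2b ∘ LEAD p676660 one-c′ threshold)
    exact
      Theorems.PowerGaugeEulerLiouville.Loc.selfSimilar_ae_eq_zero_of_criticalSpikesC2_profile
        hρ hρh h.1 h.2.1 h.2.2 hss.1 hss.2 hV hsp
  · -- v105 alt 8: K-TJ′ straight slow∧high runs (hoop line; face `HasStraightSlowHighRuns` by name; member ns-ezl-w3 g7 p695071)
    exact
      Theorems.PowerGaugeEulerLiouville.Loc.selfSimilar_ae_eq_zero_of_straightSlowHighRunsC2_profile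
        hρ hρh h.1 h.2.1 h.2.2 hss.1 hss.2 hV hrun
  · -- v106 alt 9: K-TJ″ (alt 8′) straight slow∧high runs with quiet end caps (face `HasStraightSlowHighRunsFree` by name; member ns-ezl-w3 g7)
    exact
      Theorems.PowerGaugeEulerLiouville.Loc.selfSimilar_ae_eq_zero_of_straightSlowHighRunsFreeC2_profile
        hρ hρh h.1 h.2.1 h.2.2 hss.1 hss.2 hV hrunF
  · -- v108 alt 10: K-TJ‴ (alt 8″) straight slow∧high runs inside a quiet wall of radius βb (face `HasStraightSlowHighRunsBare` by name; member ns-ezl-w3 g7)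
    exact
      Theorems.PowerGaugeEulerLiouville.Loc.selfSimilar_ae_eq_zero_of_straightSlowHighRunsBareC2_profile
        hρ hρh h.1 h.2.1 h.2.2 hss.1 hss.2 hV hrunB
  · -- v108 alt 11: pressure-ridge runs (face `HasStraightRidgeRuns` by name; member ns-ezl-w3 g7 over sfl-p1's `ridgeRunEnergyLaw`)
    exact
      Theorems.PowerGaugeEulerLiouville.Loc.selfSimilar_ae_eq_zero_of_straightRidgeRunsC2_profile
        hρ hρh h.1 h.2.1 h.2.2 hss.1 hss.2 hV hridge
  · -- v109 alt 12: FAT FAST CORE (R52 §D; face `HasFatFastCore` by name; member ns-ezl-w3 g7 p703027 over sfl-p1 g9's radial capacity lemma + E-TAIL)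
    exact
      Theorems.PowerGaugeEulerLiouville.Loc.selfSimilar_ae_eq_zero_of_fatFastCoreC2_profile
        hρ hρh h.1 h.2.1 h.2.2 hss.1 hss.2 hV hfat
  · -- v111 alt 13: R53 face «L^q vorticity» (F5); THE FLOOR composed by name: F1 sfl-p1 g9 p706438 + F3a LEAD g15 p705900 → F3 ezl-w3 g8; member LEAD g15 p706287
    exact
      Theorems.PowerGaugeEulerLiouville.Loc.selfSimilar_ae_eq_zero_of_hasLqVorticityC2_profile_of_floor
        hρ hρh h.1 h.2.1 h.2.2 hss.1 hss.2 hV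
        (Theorems.PowerGaugeEulerLiouville.MomentFloor.momentFloorLaw hρ (by linarith) V) hLq
  · -- v111 alt 14: R53 face «sub-borderline vorticity in q-mean» (THE FLOOR's denial); same composition; member LEAD g15 p706287
    exact
      Theorems.PowerGaugeEulerLiouville.Loc.selfSimilar_ae_eq_zero_of_subBorderlineC2_profile_of_floor
        hρ hρh h.1 h.2.1 h.2.2 hss.1 hss.2 hV
        (Theorems.PowerGaugeEulerLiouville.MomentFloor.momentFloorLaw hρ (by linarith) V) hsub

/-- STUB `stub_selfSimilarBoundedBernoulli` [FILLED BY NAME; credits: CENSUS-vNN]. -/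
theorem stub_selfSimilarBoundedBernoulli : Sig.stub_selfSimilarBoundedBernoulli := by
  intro ρ hρ hρh u p H c V P h hss hV hbb
  rcases hbb with hbb | ⟨hB, hQ⟩
  · exact
      Theorems.PowerGaugeEulerLiouville.Loc.selfSimilar_ae_eq_zero_of_vorticalBoundedBernoulliC2_profile
        hρ hρh h.1 h.2.2 hss.1 hss.2 hV hbb
  · -- v78: the T2 stratum in growth form
    exact
      Theorems.PowerGaugeEulerLiouville.PressureParking.selfSimilar_ae_eq_zero_of_strainExcessGrowth_boundedVorticalBernoulliC2_profile
        hρ hρh h.1 h.2.2 hss.1 hss.2 hV hB hQ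

/-- STUB 4fc [FILLED BY NAME; fillers and credits: CENSUS-19832-vNN.md, branch comments below]. -/
theorem stub_selfSimilarFastChannel : Sig.stub_selfSimilarFastChannel := by
  intro ρ hρ hρh u p H c V P h hss hV hfc
  rcases hfc with ⟨c₁, hc₁, hB⟩ | ⟨c₁, μ, hc₁, hμ, hB⟩ | ⟨c₁, μ, hc₁, hμ, hB⟩ | ⟨κb, a₀, hκb, ha₀, hB⟩ | ⟨c₁, μ, hc₁, hμ, hB⟩ | ⟨κb, a₀, hκb, ha₀, hB⟩ | ⟨κb, a₀, hκb, ha₀, hB⟩ | ⟨κb, a₀, hκb, ha₀, hB⟩ |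
      ⟨κb, a₀, e₁, e₂, hκb, ha₀, he₁, he₁ρ, he₂, he₂ρ, hB⟩ | hB10 |
      ⟨κb, a₀, e₁, e₂, hκb, ha₀, he₁, he₁ρ, he₂, he₂ρ, hB⟩ | hB12
  · exact
      Theorems.PowerGaugeEulerLiouville.Loc.selfSimilar_ae_eq_zero_of_vorticalChannelC2_profile_anyRate
        hρ hρh h.1 h.2.1 h.2.2 hss.1 hss.2 hV hc₁ hB
  · -- v84: inflow half-band deficit of the radial acceleration
    exact
      Theorems.PowerGaugeEulerLiouville.Loc.selfSimilar_ae_eq_zero_of_inflowBandDeficitC2_profile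
        hρ hρh h.1 h.2.1 h.2.2 hss.1 hss.2 hV hc₁ hμ hB
  · -- v85: virial deficit
    exact
      Theorems.PowerGaugeEulerLiouville.Loc.selfSimilar_ae_eq_zero_of_virialDeficitC2_profile
        hρ hρh h.1 h.2.1 h.2.2 hss.1 hss.2 hV hc₁ hμ hB
  · -- v86: absolute inflow-band deficit ⇒ power clock
    exact
      Theorems.PowerGaugeEulerLiouville.Loc.selfSimilar_ae_eq_zero_of_absBandDeficitC2_profile
        hρ hρh h.1 h.2.1 h.2.2 hss.1 hss.2 hV hκb ha₀ hB
  · -- v86: radial-pressure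
    exact
      Theorems.PowerGaugeEulerLiouville.Loc.selfSimilar_ae_eq_zero_of_radialPressureDeficitC2_profile
        hρ hρh h.1 h.2.1 h.2.2 hss.1 hss.2 hV hc₁ hμ hB
  · -- v87: absolute virial form (ns-ezl-w1 g6 p674543)
    exact
      Theorems.PowerGaugeEulerLiouville.Loc.selfSimilar_ae_eq_zero_of_absVirialDeficitC2_profile
        hρ hρh h.1 h.2.1 h.2.2 hss.1 hss.2 hV hκb ha₀ hB
  · -- v87: decaying floor a₀/‖y‖² ⇒ power clock (LEAD g13)
    exact
      Theorems.PowerGaugeEulerLiouville.Loc.selfSimilar_ae_eq_zero_of_decayingBandDeficitC2_profile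
        hρ hρh h.1 h.2.1 h.2.2 hss.1 hss.2 hV hκb ha₀ hB
  · -- v89: absolute radial-pressure form (ns-sfl-p1 g6 K-sfl)
    exact
      Theorems.PowerGaugeEulerLiouville.Loc.selfSimilar_ae_eq_zero_of_absRadialPressureDeficitC2_profile
        hρ hρh h.1 h.2.1 h.2.2 hss.1 hss.2 hV hκb ha₀ hB
  · -- v89: rpow power band ⇒ power clock (ns-ezl-w1 g6 T-H)
    exact
      Theorems.PowerGaugeEulerLiouville.Loc.selfSimilar_ae_eq_zero_of_powerBandDeficitC2_profile
        hρ hρh h.1 h.2.1 h.2.2 hss.1 hss.2 hV hκb ha₀ he₁ he₁ρ he₂ he₂ρ hB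
  · -- v90: invariant-region band deficit ⇒ local power clock
    exact
      Theorems.PowerGaugeEulerLiouville.Loc.selfSimilar_ae_eq_zero_of_invariantBandDeficitC2_profile
        hρ hρh h.1 h.2.1 h.2.2 hss.1 hss.2 hV hB10
  · -- v91: level form (ns-ezl-w1 g6 K-w1-LEVEL p678876)
    exact
      Theorems.PowerGaugeEulerLiouville.Loc.selfSimilar_ae_eq_zero_of_powerBandDeficitC2_level
        hρ hρh h.1 h.2.1 h.2.2 hss.1 hss.2 hV hκb ha₀ he₁ he₁ρ he₂ he₂ρ hB
  · -- v93: deficit off an a.e.-avoided set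
    exact
      Theorems.PowerGaugeEulerLiouville.Loc.selfSimilar_ae_eq_zero_of_avoidingBandDeficitC2_profile
        hρ hρh h.1 h.2.1 h.2.2 hss.1 hss.2 hV hB12

/-- STUB 4ck [FILLED BY NAME; fillers and credits: CENSUS-19832-vNN.md, branch comments below]. -/
theorem stub_selfSimilarClockedExits : Sig.stub_selfSimilarClockedExits := by
  intro ρ hρ hρh u p H c V P h hss hV hck
  rcases hck with ⟨s₁, hs₁, hclock⟩ | hclock | ⟨s, hs1, hstrain, henv⟩ | ⟨s, hs, hstrain⟩ | ⟨θ, hθ, hosc, hhover⟩ | hloc | ⟨θ', hθ', hosc', hhover'⟩ |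
    hB8 | hB9
  · exact
      Theorems.PowerGaugeEulerLiouville.NeedleRace.selfSimilar_ae_eq_zero_of_logClockC2
        hρ hρh h.1 h.2.1 h.2.2 hss.1 hss.2 hV hs₁ hclock
  · exact
      Theorems.PowerGaugeEulerLiouville.NeedleRace.selfSimilar_ae_eq_zero_of_subcriticalClockC2
        hρ hρh h.1 h.2.1 h.2.2 hss.1 hss.2 hV hclock
  · exact
      Theorems.PowerGaugeEulerLiouville.NeedleRace.selfSimilar_ae_eq_zero_of_strainClockC2
        hρ hρh h.1 h.2.1 h.2.2 hss.1 hss.2 hV hs1 hstrain henv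
  · exact
      Theorems.PowerGaugeEulerLiouville.NeedleRace.selfSimilar_ae_eq_zero_of_strongStrainClockC2
        hρ hρh h.1 h.2.1 h.2.2 hss.1 hss.2 hV hs hstrain
  · exact
      Theorems.PowerGaugeEulerLiouville.NeedleRace.selfSimilar_ae_eq_zero_of_hoveringLawC2
        hρ hρh h.1 h.2.1 h.2.2 hss.1 hss.2 hV hθ hosc hhover
  · -- v88: «one clocked ball kills» (LEAD g13, local power clock)
    exact
      Theorems.PowerGaugeEulerLiouville.NeedleRace.selfSimilar_ae_eq_zero_of_localPowerClockC2
        hρ hρh h.1 h.2.1 h.2.2 hss.1 hss.2 hV hloc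
  · -- v91: the hovering law at one ball (LEAD g13)
    exact
      Theorems.PowerGaugeEulerLiouville.NeedleRace.selfSimilar_ae_eq_zero_of_localHoveringLawC2
        hρ hρh h.1 h.2.1 h.2.2 hss.1 hss.2 hV hθ' hosc' hhover'
  · -- v92: no balanced perigee ∧ no inflow hovering ∧ no spike
    exact
      Theorems.PowerGaugeEulerLiouville.Loc.selfSimilar_ae_eq_zero_of_perigeeFastEnvelopeC2_level
        hρ hρh h.1 h.2.1 h.2.2 hss.1 hss.2 hV hB8
  · -- v94 alt 9
    exact
      Theorems.PowerGaugeEulerLiouville.Loc.selfSimilar_ae_eq_zero_of_spikesOrHoveringC2_profile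
        hρ hρh h.1 h.2.1 h.2.2 hss.1 hss.2 hV hB9

/-- STUB `stub_selfSimilarAxisymThinExits` [FILLED BY NAME; credits: CENSUS-vNN]. -/
theorem stub_selfSimilarAxisymThinExits : Sig.stub_selfSimilarAxisymThinExits := by
  intro ρ hρ hρh u p H c V P h hss hV hR
  obtain ⟨R, hax⟩ := hR
  -- v66: ANY AXIS — the generic ∃R transport of ns-ezl-w3 g3 (p643199); v76: ONE member on the conjugated profile — the axisymmetric needle has no swirl (ns-ezl-w3 g4)
  have hW : ContDiff ℝ 2 (fun y => R (V (R.symm y))) :=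
    R.toContinuousLinearEquiv.contDiff.comp (hV.comp R.symm.toContinuousLinearEquiv.contDiff)
  refine Theorems.PowerGaugeEulerLiouville.ClassIsometry.selfSimilar_ae_eq_zero_of_conj h.1 h.2.1 h.2.2 hss.1 hss.2 R ?_
  intro u' p' H' hsw' hH' hg' hu' hp'
  exact
    Theorems.PowerGaugeEulerLiouville.SwirlBudget.selfSimilar_ae_eq_zero_of_axisymC2
      hρ hρh hsw' hH' hg' hu' hp' hW hax

/-- STUB 4b-C² [OPEN — THE ONE STATEMENT (v27): exactly self-similar, extremal, `V ∈ C²` not tame — the fast-inflow NEEDLE profiles; every barrier / gauge-pointwise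
lever exhausted (CENSUS v24–v27); quantitative portrait v34 `Needle.volume_fastInflow_shell_le_of_gaugeA` p601962 (the fast-inflow set meets the shell `[L, 2L)` in volume
`≤ c (2L)^{1−2ρ}/(κL)²`); refuter-facing portrait RESIDUE-MEMO-19832-g13 and -g14]. -/
theorem stub_selfSimilarC2Needle : Sig.stub_selfSimilarC2Needle := by
  sorry

/-- STUB `stub_selfSimilarWeakConfinedCurl` [FILLED BY NAME; credits: CENSUS-vNN]. -/
theorem stub_selfSimilarWeakConfinedCurl : Sig.stub_selfSimilarWeakConfinedCurl := by
  intro ρ hρ hρh u p H c V P hcls hVP hwc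
  rcases hwc with ⟨hρ2, ⟨G, R₀, hVG, hsymm⟩ | ⟨R₀, hirr⟩ | ⟨G, hVG, hω1, hω2⟩⟩ | ⟨G, hPG, hdiv, hΘ⟩ | ⟨R, G, hPG, hdiv, hax⟩
  · exact Theorems.PowerGaugeEulerLiouville.WeakConfinedVorticity.selfSimilar_ae_eq_zero_of_confinedCurl_profile hρ hρ2 hcls.1 hcls.2.1
      hcls.2.2 hVP.1 hVP.2 hVG hsymm
  · exact Theorems.PowerGaugeEulerLiouville.WeakConfinedVorticity.selfSimilar_ae_eq_zero_of_weaklyIrrotationalFar_profile hρ hρ2 hcls.1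
      hcls.2.1 hcls.2.2 hVP.1 hVP.2 hirr
  · exact Theorems.PowerGaugeEulerLiouville.WeakConfinedVorticity.selfSimilar_ae_eq_zero_of_integrableCurl_profile hρ hρ2 hcls.1 hcls.2.1
      hcls.2.2 hVP.1 hVP.2 hVG hω1 hω2
  · -- v113 alt 4′: weak_eulerian, geometric form — E1 p705122 → E2 WeakEulerian.renormalisation → E3 p698147 («vorticity support of density zero»), every ρ ∈ (0,½]
    have hvort := Theorems.PowerGaugeEulerLiouville.WeakEulerian.weakVorticityEquation hρ hρh hcls hVP hPG hdiv
    have hren := Theorems.PowerGaugeEulerLiouville.WeakEulerian.renormalisation hρ hρh hPG hdiv hvort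
    exact Theorems.PowerGaugeEulerLiouville.WeakEulerian.supportDensityLaw hρ hρh hcls hVP hPG hdiv hren hΘ
  · -- alt 5″ (ANY AXIS): `WeakAxisym.axisymNoSwirl_trivial_anyAxis` (ns-ezl-w1 g10) = class isometry transport ∘ axisymNoSwirl_trivial (X2 ∘ X0 ∘ X1a ∘ X1b) by name
    exact Theorems.PowerGaugeEulerLiouville.WeakAxisym.axisymNoSwirl_trivial_anyAxis hρ hρh hcls hVP R hPG hdiv hax

/-- STUB 4b-weak [OPEN — the genuinely WEAK self-similar class (`V ∉ C²`; Chae–Shvydkoy's window proper), v27; v99: minus the confined-curl profiles]. -/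
theorem stub_selfSimilarWeakRest : Sig.stub_selfSimilarWeakRest := by
  sorry

/-- STUB 5 [OPEN, RESHAPED in v17/v18/v20/v21/v22/v23 — energetic-past members that are neither exactly self-similar about the origin, nor
past-exactly self-similar with a tame `C²` profile (nor shifted-exact with a critically homogeneous one), nor endpoint DSS power-spread members, nor classical DSS members
with compactly supported vorticity, nor vorticity-tame classical members, nor symmetric-weak members, nor classical-concentrating]. -/
theorem stub_nonSelfSimilarRest : Sig.stub_nonSelfSimilarRest := by
  sorry

/-- **The exactly-self-similar branch, factored (NEW in v62): ten stubs ⇒ every exactly self-similar member of the class at EVERY window exponent is trivial.**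
(Used at the class exponent after origin pressure slaving, and at the clock's own exponent after the centre/exponent transfer.)  No sorry of its own. -/
theorem selfSimilarBranch_of :
    Sig.stub_classicalConcentrating → Sig.stub_selfSimilarKinematicTame → Sig.stub_selfSimilarSubExtremal → Sig.stub_selfSimilarClassical →
      Sig.stub_selfSimilarEndpointPowerSpread → Sig.stub_selfSimilarBoundedBernoulli → Sig.stub_selfSimilarFastChannel → Sig.stub_selfSimilarClockedExits → Sig.stub_selfSimilarAxisymThinExits →
      Sig.stub_selfSimilarC2Needle → Sig.stub_selfSimilarWeakConfinedCurl → Sig.stub_selfSimilarWeakRest →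
      ∀ ρ : ℝ, 0 < ρ → ρ ≤ 1 / 2 →
        ∀ (u : ℝ → E3 → E3) (p : ℝ → E3 → ℝ) (H : ℝ → E3 → E3 →L[ℝ] E3) (c : ℝ≥0) (V : E3 → E3) (P : E3 → ℝ),
          InClass ρ u p H c → IsExactlySelfSimilar ρ u p V P →
            Function.uncurry u =ᵐ[volume.restrict (Set.Iio (0 : ℝ) ×ˢ (Set.univ : Set E3))] 0 := by
  intro hcc h4cp h3 h4a h4e h4bb h4fc h4ck h4ax h4bC h4wc h4bW ρ hρ hρh u p H c V P hcls hVP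
  by_cases hk' : IsClassicalConcentrating ρ u p
  · exact hcc ρ hρ hρh u p H c hcls hk'
  by_cases hcp : ContDiff ℝ 2 V ∧ IsKinematicTameProfile ρ c V
  · exact h4cp ρ hρ hρh u p H c V P hcls hVP hcp.1 hcp.2
  by_cases hex : IsExtremalProfile ρ V
  · by_cases hcl : IsTameC2Profile ρ V ∨ IsHomogeneousProfile ρ V
    · exact h4a ρ hρ hρh u p H c V P hcls hVP hcl
    · by_cases hps : ρ = 1 / 2 ∧ IsPowerSpreadProfile V
      · exact h4e ρ hρ hρh u p H c V P hcls hVP hps.1 hps.2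
      · by_cases hwc : IsWeakConfinedCurl ρ V
        · exact h4wc ρ hρ hρh u p H c V P hcls hVP hwc
        by_cases hC2 : ContDiff ℝ 2 V
        · by_cases hbb : HasTameVorticalBernoulli ρ V
          · exact h4bb ρ hρ hρh u p H c V P hcls hVP hC2 hbb
          by_cases hfc : HasFastVorticalChannel ρ V
          · exact h4fc ρ hρ hρh u p H c V P hcls hVP hC2 hfc
          by_cases hck : HasResidenceClock ρ V
          · exact h4ck ρ hρ hρh u p H c V P hcls hVP hC2 hck
          by_cases hax : ∃ R : E3 ≃ₗᵢ[ℝ] E3, Literature.Analysis.FluidPDE.IsAxisymmetric (fun y => R (V (R.symm y)))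
          · exact h4ax ρ hρ hρh u p H c V P hcls hVP hC2 hax
          exact h4bC ρ hρ hρh u p H c V P hcls hVP hex hC2 (fun hk => hcp ⟨hC2, hk⟩) (fun hpi => hcl (Or.inl ⟨hC2, Or.inr hpi⟩)) hbb hfc hck hax hwc
        · exact h4bW ρ hρ hρh u p H c V P hcls hVP hex hC2 (fun hh => hcl (Or.inr hh)) hps hk' hwc
  · exact h3 ρ hρ hρh u p H c V P hcls hVP hex

/-- **Composition (kernel-checked, no sorry of its own): the fifty-two stubs give the crux BY NAME.** -/
theorem PowerGaugeEulerLiouville_of :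
    Sig.stub_largeRho → Sig.stub_quiescentPast → Sig.stub_pastSteady → Sig.stub_weakTamePast → Sig.stub_pastFrozenDirection → Sig.stub_oneSidedPressurePast → Sig.stub_extinctConservative →
      Sig.stub_swirlFreeSlowDrifting → Sig.stub_mirrorOutgoing → Sig.stub_slabBoundedSwirlFree → Sig.stub_slabBoundedSwirlFreeAnyAxis → Sig.stub_axisymSlowDrifting → Sig.stub_axisymSlowDriftingAnyAxis → Sig.stub_tameBreather → Sig.stub_discreteBreather → Sig.stub_discreteClock →
      Sig.stub_offRateSelfSimilar → Sig.stub_selfSimilarKinematicTame →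
      Sig.stub_tameShapePreserving → Sig.stub_classicalConcentrating →
      Sig.stub_selfSimilarSubExtremal → Sig.stub_selfSimilarClassical → Sig.stub_shiftedSelfSimilarClassical →
      Sig.stub_pastSelfSimilarSubExtremal → Sig.stub_pastSpiralSubExtremal → Sig.stub_pastSpiralTameWeak → Sig.stub_shapeFastClock →
      Sig.stub_swirlFreeDrifting → Sig.stub_bernoulliClockedCore → Sig.stub_helicalTubePast → Sig.stub_chiralTubePast → Sig.stub_stretchingBudgeted → Sig.stub_anchoredBudgeted →
      Sig.stub_confinedVortex → Sig.stub_fadingTamePast →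
      Sig.stub_selfSimilarEndpointPowerSpread → Sig.stub_dssEndpointPowerSpread → Sig.stub_dssCompactVorticity →
      Sig.stub_dssClassicalTame → Sig.stub_dssClassicalTameAnyAxis → Sig.stub_dssClassicalEnergy → Sig.stub_smallTypeIGradient → Sig.stub_weakFluxTame → Sig.stub_symmetricWeak → Sig.stub_selfSimilarBoundedBernoulli → Sig.stub_selfSimilarFastChannel → Sig.stub_selfSimilarClockedExits → Sig.stub_selfSimilarAxisymThinExits → Sig.stub_selfSimilarC2Needle → Sig.stub_selfSimilarWeakConfinedCurl → Sig.stub_selfSimilarWeakRest →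
      Sig.stub_nonSelfSimilarRest →
      Summit.NavierStokesRegularity.NavierStokesRegularity.Theses.EulerZoomLiouville.PowerGaugeEulerLiouville := by
  intro h1 h2 h2s h2w h2f h2p h2x h5k h5mo h5sbf h5sba h5ax h5axa h5tb h5db h5dc h5or h4cp h5ts hcc h3 h4a h4s h4p h4sp h4tw h5s h5a h5bc h5ht h5ct h5sb h5ab h5v h5b h4e h5e h5c h5d h5dta h5g h5t h5f h5w h4bb h4fc h4ck h4ax h4bC h4wc h4bW h5 ρ hρ u p H c hsw hH hc
  by_cases hhalf : 1 / 2 < ρ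
  · exact h1 ρ hhalf u p H c ⟨hsw, hH, hc⟩
  · by_cases hq : QuiescentPast u
    · exact h2 ρ hρ (not_lt.mp hhalf) u p H c ⟨hsw, hH, hc⟩ hq
    · by_cases hpst : IsPastSteady ρ u
      · exact h2s ρ hρ (not_lt.mp hhalf) u p H c ⟨hsw, hH, hc⟩ hpst
      by_cases hwtp : IsWeakTamePast u H
      · exact h2w ρ hρ (not_lt.mp hhalf) u p H c ⟨hsw, hH, hc⟩ hwtp
      by_cases hfd : PastFrozenDirection H
      · exact h2f ρ hρ (not_lt.mp hhalf) u p H c ⟨hsw, hH, hc⟩ hfd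
      by_cases hosp : HasOneSidedPressurePast ρ u p
      · exact h2p ρ hρ (not_lt.mp hhalf) u p H c ⟨hsw, hH, hc⟩ hosp
      by_cases hxc : IsExtinctConservative ρ u p
      · exact h2x ρ hρ (not_lt.mp hhalf) u p H c ⟨hsw, hH, hc⟩ hxc
      by_cases hk : IsClassicalConcentrating ρ u p
      · exact hcc ρ hρ (not_lt.mp hhalf) u p H c ⟨hsw, hH, hc⟩ hk
      · by_cases hsym : IsSymmetricWeak u H
        · exact h5w ρ hρ (not_lt.mp hhalf) u p H c ⟨hsw, hH, hc⟩ hsym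
        by_cases hsh : IsPastSelfSimilarClassical ρ u
        · exact h4s ρ hρ (not_lt.mp hhalf) u p H c ⟨hsw, hH, hc⟩ hsh
        · by_cases hpsub : IsPastSelfSimilarSubExtremal ρ u
          · exact h4p ρ hρ (not_lt.mp hhalf) u p H c ⟨hsw, hH, hc⟩ hpsub
          by_cases hpsp : IsPastSpiralSubExtremal ρ u
          · exact h4sp ρ hρ (not_lt.mp hhalf) u p H c ⟨hsw, hH, hc⟩ hpsp
          by_cases hptw : IsPastSpiralTameWeak ρ u
          · exact h4tw ρ hρ (not_lt.mp hhalf) u p H c ⟨hsw, hH, hc⟩ hptw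
          by_cases hsfc : IsShapeFastClock ρ u
          · exact h5s ρ hρ (not_lt.mp hhalf) u p H c ⟨hsw, hH, hc⟩ hsfc
          by_cases hsfd : IsSwirlFreeDrifting u p
          · exact h5a ρ hρ (not_lt.mp hhalf) u p H c ⟨hsw, hH, hc⟩ hsfd
          by_cases hssd : IsSwirlFreeSlowDrifting ρ u p
          · exact h5k ρ hρ (not_lt.mp hhalf) u p H c ⟨hsw, hH, hc⟩ hssd
          by_cases hmo : IsMirrorOutgoing ρ u p
          · exact h5mo ρ hρ (not_lt.mp hhalf) u p H c ⟨hsw, hH, hc⟩ hmo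
          by_cases hsbf : IsSlabBoundedSwirlFree u p
          · exact h5sbf ρ hρ (not_lt.mp hhalf) u p H c ⟨hsw, hH, hc⟩ hsbf
          by_cases hsba : (∃ R : E3 ≃ₗᵢ[ℝ] E3, IsSlabBoundedSwirlFree (fun τ x => R (u τ (R.symm x))) (fun τ x => p τ (R.symm x)))
          · exact h5sba ρ hρ (not_lt.mp hhalf) u p H c ⟨hsw, hH, hc⟩ hsba
          by_cases hax : IsAxisymSlowDrifting ρ u p
          · exact h5ax ρ hρ (not_lt.mp hhalf) u p H c ⟨hsw, hH, hc⟩ hax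
          by_cases haxa : (∃ R : E3 ≃ₗᵢ[ℝ] E3, IsAxisymSlowDrifting ρ (fun τ x => R (u τ (R.symm x))) (fun τ x => p τ (R.symm x)))
          · exact h5axa ρ hρ (not_lt.mp hhalf) u p H c ⟨hsw, hH, hc⟩ haxa
          by_cases htb : IsTameBreather ρ u p
          · exact h5tb ρ hρ (not_lt.mp hhalf) u p H c ⟨hsw, hH, hc⟩ htb
          by_cases hdb : IsDiscreteBreather ρ u
          · exact h5db ρ hρ (not_lt.mp hhalf) u p H c ⟨hsw, hH, hc⟩ hdb
          by_cases hdcl : IsDiscreteClock ρ u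
          · exact h5dc ρ hρ (not_lt.mp hhalf) u p H c ⟨hsw, hH, hc⟩ hdcl
          by_cases hoff : IsOffRateSelfSimilar ρ u
          · exact h5or ρ hρ (not_lt.mp hhalf) u p H c ⟨hsw, hH, hc⟩ hoff
          by_cases hbcc : IsBernoulliClockedCore u p
          · exact h5bc ρ hρ (not_lt.mp hhalf) u p H c ⟨hsw, hH, hc⟩ hbcc
          by_cases hht : IsHelicalTubePast ρ u p
          · exact h5ht ρ hρ (not_lt.mp hhalf) u p H c ⟨hsw, hH, hc⟩ hht
          by_cases hct : IsChiralTubePast u p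
          · exact h5ct ρ hρ (not_lt.mp hhalf) u p H c ⟨hsw, hH, hc⟩ hct
          by_cases hsb : IsStretchingBudgeted ρ u p
          · exact h5sb ρ hρ (not_lt.mp hhalf) u p H c ⟨hsw, hH, hc⟩ hsb
          by_cases hab : IsAnchoredBudgeted ρ u p
          · exact h5ab ρ hρ (not_lt.mp hhalf) u p H c ⟨hsw, hH, hc⟩ hab
          by_cases hcv : IsConfinedVortex ρ u p
          · exact h5v ρ hρ (not_lt.mp hhalf) u p H c ⟨hsw, hH, hc⟩ hcv
          by_cases hftp : IsFadingTamePast u p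
          · exact h5b ρ hρ (not_lt.mp hhalf) u p H c ⟨hsw, hH, hc⟩ hftp
          by_cases htsp : IsTameClassicalShapePreserving ρ u p
          · exact h5ts ρ hρ (not_lt.mp hhalf) u p H c ⟨hsw, hH, hc⟩ htsp
          have hSS := selfSimilarBranch_of hcc h4cp h3 h4a h4e h4bb h4fc h4ck h4ax h4bC h4wc h4bW
          by_cases hck : IsCollapseClockC2 u
          · -- THE CENTRE/EXPONENT TRANSFER
            -- an origin-centred member of the class of exponent ρ′ with the same profile
            obtain ⟨T, x₀, ρ', W, hT, hρ'0, hρ'1, hW, hu⟩ := hck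
            obtain ⟨Q, p', -, hp', -, h'⟩ :=
              Theorems.PowerGaugeEulerLiouville.PressureSlaving.inClass_pastSelfSimilarPressure
                (g := 1 / (2 + ρ')) (by linarith) hT le_rfl ⟨hsw, hH, hc⟩ hu
            by_cases hρ'h : ρ' ≤ 1 / 2
            · exact Theorems.PowerGaugeEulerLiouville.ClockTransfer.ae_eq_zero_of_originAnalysis
                hρ.le (by linarith) hρ'1 h'.1 h'.2.1 h'.2.2 hT x₀ hu hp' hW
                (fun u' p' H' c' hcls hss => hSS ρ' hρ'0 hρ'h u' p' H' c' W Q hcls hss)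
            · exact Theorems.PowerGaugeEulerLiouville.ClockTransfer.ae_eq_zero_of_originAnalysis
                hρ.le (by linarith) hρ'1 h'.1 h'.2.1 h'.2.2 hT x₀ hu hp' hW
                (fun u' p' H' c' hcls _ => h1 ρ' (not_le.mp hρ'h) u' p' H' c' hcls)
          by_cases hssv : IsSelfSimilarVelocity u
          · -- PRESSURE SLAVING
            obtain ⟨g, V, hu⟩ := hssv
            obtain ⟨Q, -, -, hcls'⟩ :=
              Theorems.PowerGaugeEulerLiouville.PressureSlaving.inClass_selfSimilarPressure (by linarith) ⟨hsw, hH, hc⟩ hu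
            by_cases hg : g = 1 / (2 + ρ)
            · subst hg
              exact hSS ρ hρ (not_lt.mp hhalf) u _ H c V Q hcls' ⟨hu, fun τ _ => rfl⟩
            · exact h5or ρ hρ (not_lt.mp hhalf) u p H c ⟨hsw, hH, hc⟩ (Or.inl ⟨g, V, hg, hu⟩)
          · by_cases hde : ρ = 1 / 2 ∧ IsDSSPowerSpread ρ u
            · exact h5e ρ hρ (not_lt.mp hhalf) u p H c ⟨hsw, hH, hc⟩ hde.1 hde.2
            · by_cases hdc : IsDSSCompactVorticity ρ u p
              · exact h5c ρ hρ (not_lt.mp hhalf) u p H c ⟨hsw, hH, hc⟩ hdc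
              · by_cases hdt : IsDSSClassicalTame ρ u p
                · exact h5d ρ hρ (not_lt.mp hhalf) u p H c ⟨hsw, hH, hc⟩ hdt
                by_cases hdta : (∃ R : E3 ≃ₗᵢ[ℝ] E3, IsDSSClassicalTame ρ (fun τ x => R (u τ (R.symm x))) (fun τ x => p τ (R.symm x)))
                · exact h5dta ρ hρ (not_lt.mp hhalf) u p H c ⟨hsw, hH, hc⟩ hdta
                by_cases hdg : IsDSSClassicalEnergy ρ u p
                · exact h5g ρ hρ (not_lt.mp hhalf) u p H c ⟨hsw, hH, hc⟩ hdg
                by_cases hft : IsWeakFluxTame u p H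
                · exact h5f ρ hρ (not_lt.mp hhalf) u p H c ⟨hsw, hH, hc⟩ hft
                by_cases hst : IsClassicalVorticityTame u p
                · exact h5t ρ hρ (not_lt.mp hhalf) u p H c ⟨hsw, hH, hc⟩ hst
                · exact h5 ρ hρ (not_lt.mp hhalf) u p H c ⟨hsw, hH, hc⟩ hq hpst hwtp hfd hssv hck hsh hpsub hpsp hptw hsfc hsfd hssd hmo hsbf hsba hax haxa htb hdb hdcl hoff hbcc hht hct hsb hab hcv hftp htsp hosp hxc hde hdc hdt hdta hdg hst hsym hft hk

/-- The crux from the stubs (inherits the placeholders of the open stubs). -/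
theorem PowerGaugeEulerLiouville_proof :
    Summit.NavierStokesRegularity.NavierStokesRegularity.Theses.EulerZoomLiouville.PowerGaugeEulerLiouville :=
  PowerGaugeEulerLiouville_of stub_largeRho stub_quiescentPast stub_pastSteady stub_weakTamePast stub_pastFrozenDirection
    stub_oneSidedPressurePast stub_extinctConservative stub_swirlFreeSlowDrifting stub_mirrorOutgoing stub_slabBoundedSwirlFree stub_slabBoundedSwirlFreeAnyAxis stub_axisymSlowDrifting stub_axisymSlowDriftingAnyAxis stub_tameBreather stub_discreteBreather stub_discreteClock
    stub_offRateSelfSimilar stub_selfSimilarKinematicTame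
    stub_tameShapePreserving stub_classicalConcentrating
    stub_selfSimilarSubExtremal stub_selfSimilarClassical stub_shiftedSelfSimilarClassical
    stub_pastSelfSimilarSubExtremal stub_pastSpiralSubExtremal stub_pastSpiralTameWeak stub_shapeFastClock
    stub_swirlFreeDrifting stub_bernoulliClockedCore stub_helicalTubePast stub_chiralTubePast stub_stretchingBudgeted stub_anchoredBudgeted stub_confinedVortex stub_fadingTamePast
    stub_selfSimilarEndpointPowerSpread stub_dssEndpointPowerSpread stub_dssCompactVorticity stub_dssClassicalTame stub_dssClassicalTameAnyAxis stub_dssClassicalEnergy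
    stub_smallTypeIGradient stub_weakFluxTame
    stub_symmetricWeak stub_selfSimilarBoundedBernoulli stub_selfSimilarFastChannel stub_selfSimilarClockedExits stub_selfSimilarAxisymThinExits
    stub_selfSimilarC2Needle stub_selfSimilarWeakConfinedCurl stub_selfSimilarWeakRest stub_nonSelfSimilarRest

end Summit.NavierStokesRegularity.NavierStokesRegularity.Cruxes.PowerGaugeEulerLiouville.Birth
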